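import Summits.RiemannHypothesis.RiemannHypothesis.Theorems.TiltedLandingLaw421R3Lens1ArcSignI
import Summits.RiemannHypothesis.RiemannHypothesis.Theorems.TiltedLandingLaw421R3NestedSign

-- ======== AtomicSplit-v2 852279c2c33faab4 (part J; import lines stripped) ========

/-!
# TiltedLandingLaw421R3 — lens-1 (part J): the ATOMIC SPLIT of the crossing-mate residual

LENS-1 gen-7 module image `rh33346-cover/lens-1/AtomicSplit-v1.lean` (landing target `…/Theorems/TiltedLandingLaw421R3Lens1ArcSignJ.lean`; single
SHAPE v2 («≤ 1 net-ascending bad piece») is DEAD on the full residual (W7, cluster `P = 3`, two ascending pieces) but ALIVE on the ATOMIC class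
(`P = 2`: C6 g38 seal census 0 / 522 885); so the residual `TopPinningNonNestedAscResidual` (part I) is split by cluster size.

CONTENT. §1 MATES and the ATOMIC class: `IsMate` (= the negation of `JensenIsolated`ʼs clause at one zero), `OffChain`, `Atomic f j a v` («`v` is the
ONE interior crossing mate of `a` and the cluster is exactly `{a, v}`»), `AscLeOne` / `NetLeOne` (the shape in part Fʼs sign-word currency: on every small
circle outside finitely many radii, `#asc ≤ 1`, resp. `#asc ≤ #desc + 1`), ★ `AtomicShapeLawQ`, `AtomicNetLawQ`, ★ `NonAtomicTopResidualQ`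
(statements) · §2 `two_mul_card_le_nonrealZeroMult`, `four_le_nonrealZeroMult` (an interior second upper zero gives `N ≥ 4`, PROVED) · §3 ★ RUNG 4
`pinning_of_netLeOne` (PROVED: interior second upper zero + `NetLeOne` ⇒ the disjunction, by part Hʼs CONVERSION) · §4 ★ the PROVED glued split
`topPinningResidual_of_split : AtomicShapeLawQ → NonAtomicTopResidualQ → TopPinningNonNestedAscResidual` (and `topPinning_of_split`) · §5 ☆ PIN-P3
candidate `CentralChildDiscQ` (statement only; binder of nothing).

«ATOMIC» PRECISELY (= C6ʼs census class, seal g38): `v ≠ a` is an upper zero of the same `f^{(j)}` with `‖v − Re a‖ ≤ Im a` (INTERIOR: inside or on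
`a`ʼs Jensen circle), `Im a ≤ |Re a − Re v| + Im v` (not strictly nested: `v`ʼs closed Jensen disc reaches `a`ʼs circle — a CROSSING mate), and every
third upper zero is strictly disc-apart from both `a` and `v` (OFF-CHAIN; so the cluster of `a` is `{a, v}` and nothing is nested in either).
«NET-ASCENDING PIECE» PRECISELY: an element of part Fʼs `ascStarts f j a δ` (a bad piece of the circle `|w − Re a| = Im a + δ` entered with `Re φ < 0` and
left with `Re φ > 0`); «in J»: on the atomic class every bad point of a small circle lies in the lens `J = C ∩ D_v` (gen-7 memo, lemma BadInLens — not
part of the typed law, which only counts).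

HONEST LABEL / PRICE: the split is EXACT bookkeeping plus ONE proved rung (RUNG 4); it prices the atomic class DOWN TO a pure sign-word statement
(`AscLeOne`), it does not prove it.  `AtomicShapeLawQ`, `NonAtomicTopResidualQ`, `TopPinning`, 33346, 33347 OPEN; nothing here bears on the truth of
RH; RH is not proved; checked ≠ landed ≠ proved.
-/

noncomputable section

namespace RhW08.Lens1ArcSign

open Complex Set Metric Filter Topology
open scoped Real
open Literature.Topology.PlaneTopology Literature.Analysis.Complex
open Summit.RiemannHypothesis.RiemannHypothesis.Theorems.Splittings.JensenWindow
open RhIdea6.G17.W07C7 RhIdea6.G17.W07C7.Rev6 RhIdea6.G18.W07C8.Law421BirthS RhIdea6.G19.W07C11.Seam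
open RhIdea6.G20.W07C12.Frac RhIdea6.G20.W07C12.StColP RhW07.C12.FieldSplit RhIdea6.G21.W07C13.TentMax
open RhW07.C14.TwoSided RhW07.C14.Classes RhW07.C14.Lineage RhW07.C14.Booking
open RhW07.C13.Heredity RhIdea6.G22.W07C15pre.Injection RhW07.E3.Cell RhW07.E3.Lit
open RhW08.Round1 RhW08.StSwap RhW08.Round2 RhW08.QuadW RhW08.SealSwapQ RhW08.SealSwap RhW08.SuccB RhW08.SuccSplit
open RhW08.SuccTheft RhW08.Column RhW08.Hurwitz RhW08.ClusterQ RhW08.ClusterQM RhW08.NewtonDoor RhW08.NewtonDoorGenusOne RhW08.PurseP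
open RhW08.Lens1SignCut RhW08.Lens1Coverage RhW08.IsolatedTilt RhW08.Lens1Pinning RhW08.Lens1PinningIso

/-! ## §1 Mates, the atomic class, the shape laws -/

/-- `c` is a MATE of the upper zero `a` of `f^{(j)}`: another upper zero whose closed Jensen disc is neither strictly apart from `a`ʼs nor strictly
nested in it — the negation of `JensenIsolated`ʼs clause at `c`. -/
def IsMate (f : ℂ → ℂ) (j : ℕ) (a c : ℂ) : Prop :=
  iteratedDeriv j f c = 0 ∧ 0 < c.im ∧ c ≠ a ∧ ¬ (a.im + c.im < |a.re - c.re| ∨ |a.re - c.re| + c.im < a.im)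

/-- `¬ JensenIsolated` = some mate exists. -/
theorem exists_isMate_of_not_jensenIsolated {f : ℂ → ℂ} {j : ℕ} {a : ℂ} (hJ : ¬ JensenIsolated f j a) : ∃ c, IsMate f j a c := by
  by_contra h
  push Not at h
  exact hJ fun c hc hcpos hca => by
    by_contra hnot
    exact h c ⟨hc, hcpos, hca, hnot⟩

/-- A mate witnesses non-isolation: `IsMate f j a c → ¬ JensenIsolated f j a`. -/
theorem not_jensenIsolated_of_isMate {f : ℂ → ℂ} {j : ℕ} {a c : ℂ} (h : IsMate f j a c) : ¬ JensenIsolated f j a :=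
  fun hJ => h.2.2.2 (hJ c h.1 h.2.1 h.2.2.1)

/-- OFF-CHAIN: every upper zero of `f^{(j)}` other than `a`, `v` is strictly disc-apart from both. -/
def OffChain (f : ℂ → ℂ) (j : ℕ) (a v : ℂ) : Prop :=
  ∀ c : ℂ, iteratedDeriv j f c = 0 → 0 < c.im → c ≠ a → c ≠ v → a.im + c.im < |a.re - c.re| ∧ v.im + c.im < |v.re - c.re|

/-- ★ ATOMIC: `v` is the ONE INTERIOR CROSSING MATE of `a` and the cluster is exactly `{a, v}` (module docstring). -/
def Atomic (f : ℂ → ℂ) (j : ℕ) (a v : ℂ) : Prop :=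
  iteratedDeriv j f v = 0 ∧ 0 < v.im ∧ v ≠ a ∧ ‖v - (a.re : ℂ)‖ ≤ a.im ∧ a.im ≤ |a.re - v.re| + v.im ∧ OffChain f j a v

/-- The atomic mate is a mate … -/
theorem isMate_of_atomic {f : ℂ → ℂ} {j : ℕ} {a v : ℂ} (hA : Atomic f j a v) : IsMate f j a v := by
  obtain ⟨hv, hvpos, hva, hvin, hnn, -⟩ := hA
  refine ⟨hv, hvpos, hva, ?_⟩
  have h1 : |a.re - v.re| ≤ ‖v - (a.re : ℂ)‖ := by
    have := abs_re_le_norm (v - (a.re : ℂ))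
    rw [sub_re, ofReal_re, abs_sub_comm] at this
    exact this
  rintro (h | h) <;> linarith

/-- … and the only one. -/
theorem eq_of_isMate_of_atomic {f : ℂ → ℂ} {j : ℕ} {a v c : ℂ} (hA : Atomic f j a v) (hc : IsMate f j a c) : c = v := by
  by_contra hcv
  exact hc.2.2.2 (Or.inl (hA.2.2.2.2.2 c hc.1 hc.2.1 hc.2.2.1 hcv).1)

/-- SHAPE v3 in part Fʼs currency: on every small Jensen circle of `a` outside finitely many radii there is AT MOST ONE net-ascending bad piece. -/
def AscLeOne (f : ℂ → ℂ) (j : ℕ) (a : ℂ) : Prop :=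
  ∃ d0 > 0, ∃ E : Set ℝ, E.Finite ∧ ∀ δ ∈ Ioo 0 d0 \ E, (ascStarts f j a δ).Finite ∧ (ascStarts f j a δ).ncard ≤ 1

/-- Its NET weakening (all the split consumes): `#asc ≤ #desc + 1` on the same circles. -/
def NetLeOne (f : ℂ → ℂ) (j : ℕ) (a : ℂ) : Prop :=
  ∃ d0 > 0, ∃ E : Set ℝ, E.Finite ∧ ∀ δ ∈ Ioo 0 d0 \ E, (ascStarts f j a δ).Finite ∧ (ascStarts f j a δ).ncard ≤ (descStarts f j a δ).ncard + 1

/-- `AscLeOne ⇒ NetLeOne` (at most one ascending piece certainly gives `#asc ≤ #desc + 1`). -/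
theorem netLeOne_of_ascLeOne {f : ℂ → ℂ} {j : ℕ} {a : ℂ} (h : AscLeOne f j a) : NetLeOne f j a := by
  obtain ⟨d0, hd0, E, hE, hA⟩ := h
  exact ⟨d0, hd0, E, hE, fun δ hδ => ⟨(hA δ hδ).1, (hA δ hδ).2.trans (by omega)⟩⟩

/-- ★ THE ATOMIC SHAPE LAW (OPEN; census 0 / 522 885, C6 seal g38): on a legal frame, a top (`NoTallerToucher`) upper zero `a` of `f^{(j)}` with an
ATOMIC mate `v`, both simple, has at most one net-ascending bad piece on every small Jensen circle outside finitely many radii. -/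
def AtomicShapeLawQ : Prop :=
  ∀ (η : ℝ) (f : ℂ → ℂ) (x₀ s hmax R Hs : ℝ) (B : ℕ), EngineHyps5 2 η f x₀ s hmax R Hs B → ∀ (j : ℕ) (a v : ℂ),
    iteratedDeriv j f a = 0 → 0 < a.im → NoTallerToucher f j a → Atomic f j a v →
    iteratedDeriv (j + 1) f a ≠ 0 → iteratedDeriv (j + 1) f v ≠ 0 → AscLeOne f j a

/-- Its net form (OPEN, weaker). -/
def AtomicNetLawQ : Prop :=
  ∀ (η : ℝ) (f : ℂ → ℂ) (x₀ s hmax R Hs : ℝ) (B : ℕ), EngineHyps5 2 η f x₀ s hmax R Hs B → ∀ (j : ℕ) (a v : ℂ),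
    iteratedDeriv j f a = 0 → 0 < a.im → NoTallerToucher f j a → Atomic f j a v →
    iteratedDeriv (j + 1) f a ≠ 0 → iteratedDeriv (j + 1) f v ≠ 0 → NetLeOne f j a

/-- The SHAPE law implies the NET law: `AtomicShapeLawQ → AtomicNetLawQ`. -/
theorem atomicNetLaw_of_atomicShapeLaw (h : AtomicShapeLawQ) : AtomicNetLawQ :=
  fun η f x₀ s hmax R Hs B hE j a v ha hapos hN hA hda hdv => netLeOne_of_ascLeOne (h η f x₀ s hmax R Hs B hE j a v ha hapos hN hA hda hdv)

/-- ★ THE NON-ATOMIC RESIDUAL (OPEN): part Iʼs residual `TopPinningNonNestedAscResidual` restricted to tops with NO atomic mate — i.e. cluster size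
`P ≥ 3` (two distinct mates, or a third zero chained to the mate), or the unique mate is EXTERIOR (`‖v − Re a‖ > Im a`). -/
def NonAtomicTopResidualQ : Prop :=
  ∀ (η : ℝ) (f : ℂ → ℂ) (x₀ s hmax R Hs : ℝ) (B : ℕ), EngineHyps5 2 η f x₀ s hmax R Hs B → ∀ (j : ℕ) (a : ℂ),
    iteratedDeriv j f a = 0 → 0 < a.im → NoTallerToucher f j a → ¬ JensenIsolated f j a → ¬ ArcSignClear f j a → ¬ ArcNoAsc f j a →
    ¬ ArcNetNonAsc f j a → (∀ u : ℂ, iteratedDeriv j f u = 0 → 0 < u.im → NestedIn a u → ¬ ArcNetNonAsc f j u) →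
    (∀ v : ℂ, ¬ Atomic f j a v) →
    (∃ w : ℂ, iteratedDeriv (j + 1) f w = 0 ∧ w.im ≠ 0 ∧ NestedStep a w) ∨ (∃ x : ℝ, |x - a.re| ≤ a.im ∧ NLEventOf f j x)

/-! ## §2 An interior second upper zero gives `N ≥ 4` -/

/-- Upper zeros of a real entire `G ≢ 0` in a disc centred on `ℝ` count twice in `nonrealZeroMult` (they and their conjugates). -/
theorem two_mul_card_le_nonrealZeroMult {G : ℂ → ℂ} (hG : Differentiable ℂ G) (hne : G ≠ 0) (hreal : ∀ x : ℝ, (G x).im = 0)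
    {c r : ℝ} (hr : 0 < r) (S : Finset ℂ) (hS : ∀ ρ ∈ S, G ρ = 0 ∧ 0 < ρ.im ∧ ρ ∈ ball (c : ℂ) r) :
    2 * (S.card : ℤ) ≤ nonrealZeroMult G c r := by
  classical
  set L : ℝ := r + 1 with hL
  have hz₀ : ((c : ℂ)) ∈ Ioo (c - L) (c + L) ×ℂ Ioo (-(r + 1)) (r + 1) :=
    ofReal_mem_box (by rw [sub_self, abs_zero]; linarith) hr.le
  have hfin : {ρ : ℂ | G ρ = 0 ∧ ρ ∈ ball (c : ℂ) r ∧ ρ.im ≠ 0}.Finite := by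
    refine (finite_zeros_box hG hne hz₀).subset ?_
    rintro ρ ⟨h0, hρ, -⟩
    refine ⟨h0, ?_⟩
    rw [mem_ball, dist_eq_norm] at hρ
    have h1 := abs_re_le_norm (ρ - (c : ℂ))
    have h2 := abs_im_le_norm (ρ - (c : ℂ))
    rw [sub_re, ofReal_re, abs_le] at h1
    rw [sub_im, ofReal_im, sub_zero, abs_le] at h2
    exact mem_reProdIm.2 ⟨⟨by linarith [h1.1], by linarith [h1.2]⟩, ⟨by linarith [h2.1], by linarith [h2.2]⟩⟩
  have hconj : ∀ ρ ∈ ball ((c : ℝ) : ℂ) r, (starRingEnd ℂ) ρ ∈ ball ((c : ℝ) : ℂ) r := by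
    intro ρ hρ
    rw [mem_ball, dist_eq_norm] at hρ ⊢
    have e : (starRingEnd ℂ) ρ - (c : ℂ) = (starRingEnd ℂ) (ρ - (c : ℂ)) := by rw [map_sub, Complex.conj_ofReal]
    rw [e, Complex.norm_conj]
    exact hρ
  have hSsub : S ⊆ hfin.toFinset := by
    intro ρ hρ
    rw [Set.Finite.mem_toFinset]
    obtain ⟨h0, hpos, hb⟩ := hS ρ hρ
    exact ⟨h0, hb, hpos.ne'⟩
  have hS'sub : S.image (starRingEnd ℂ) ⊆ hfin.toFinset := by
    intro ρ hρ
    rw [Finset.mem_image] at hρ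
    obtain ⟨σ, hσ, rfl⟩ := hρ
    obtain ⟨h0, hpos, hb⟩ := hS σ hσ
    rw [Set.Finite.mem_toFinset]
    refine ⟨by rw [apply_conj_eq_conj hG hreal, h0, map_zero], hconj σ hb, ?_⟩
    simpa using hpos.ne'
  have hdisj : Disjoint S (S.image (starRingEnd ℂ)) := by
    rw [Finset.disjoint_left]
    intro ρ hρ hρ'
    rw [Finset.mem_image] at hρ'
    obtain ⟨σ, hσ, hσρ⟩ := hρ'
    have h1 := (hS ρ hρ).2.1
    have h2 := (hS σ hσ).2.1
    have h3 : ρ.im = -σ.im := by rw [← hσρ]; simp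
    linarith
  have hU : S ∪ S.image (starRingEnd ℂ) ⊆ hfin.toFinset := Finset.union_subset hSsub hS'sub
  have hcard : ((S ∪ S.image (starRingEnd ℂ)).card : ℤ) = 2 * S.card := by
    rw [Finset.card_union_of_disjoint hdisj, Finset.card_image_of_injective _ (starRingEnd ℂ).injective]
    push_cast
    ring
  have hpos : ∀ ρ ∈ hfin.toFinset, 0 < (meromorphicOrderAt G ρ).untop₀ := by
    intro ρ hρ
    rw [Set.Finite.mem_toFinset] at hρ
    exact untop₀_order_pos hG hne hρ.1
  unfold nonrealZeroMult
  rw [finsum_mem_eq_finite_toFinset_sum _ hfin]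
  have h1 := Finset.sum_le_sum_of_subset_of_nonneg hU (fun ρ hρ _ => (hpos ρ hρ).le)
  have h2 : (S ∪ S.image (starRingEnd ℂ)).card • (1 : ℤ) ≤ ∑ ρ ∈ S ∪ S.image (starRingEnd ℂ), (meromorphicOrderAt G ρ).untop₀ :=
    Finset.card_nsmul_le_sum _ _ 1 fun ρ hρ => by have := hpos ρ (hU hρ); omega
  rw [nsmul_eq_mul, mul_one] at h2
  linarith

/-- `a` lies in each of its enlarged Jensen discs. -/
theorem self_mem_ball {a : ℂ} (hapos : 0 < a.im) {δ : ℝ} (hδ : 0 < δ) : a ∈ ball ((a.re : ℝ) : ℂ) (a.im + δ) := by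
  rw [mem_ball, dist_eq_norm]
  have e : a - (a.re : ℂ) = ((a.im : ℝ) : ℂ) * I := Complex.ext (by simp) (by simp)
  rw [e, norm_mul, Complex.norm_real, Complex.norm_I, mul_one, Real.norm_eq_abs, abs_of_pos hapos]
  linarith

/-- ★ `N ≥ 4` on every disc `|w − Re a| < Im a + δ` when a SECOND upper zero `v ≠ a` of the real entire `G ≢ 0` lies in `‖v − Re a‖ ≤ Im a`. -/
theorem four_le_nonrealZeroMult {G : ℂ → ℂ} (hG : Differentiable ℂ G) (hne : G ≠ 0) (hreal : ∀ x : ℝ, (G x).im = 0) {a v : ℂ}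
    (ha : G a = 0) (hapos : 0 < a.im) (hv : G v = 0) (hvpos : 0 < v.im) (hva : v ≠ a) (hvin : ‖v - (a.re : ℂ)‖ ≤ a.im) {δ : ℝ}
    (hδ : 0 < δ) : 4 ≤ nonrealZeroMult G a.re (a.im + δ) := by
  classical
  have hr : 0 < a.im + δ := by linarith
  have hvball : v ∈ ball ((a.re : ℝ) : ℂ) (a.im + δ) := by
    rw [mem_ball, dist_eq_norm]
    linarith
  have h := two_mul_card_le_nonrealZeroMult hG hne hreal hr {a, v} (by
    intro ρ hρ
    rcases Finset.mem_insert.1 hρ with rfl | hρ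
    · exact ⟨ha, hapos, self_mem_ball hapos hδ⟩
    · rw [Finset.mem_singleton.1 hρ]
      exact ⟨hv, hvpos, hvball⟩)
  rw [Finset.card_pair hva.symm] at h
  push_cast at h
  linarith

/-! ## §3 RUNG 4: an interior second zero and `NetLeOne` give the disjunction -/

/-- ★★★ RUNG 4 (PROVED).  On a legal frame, an upper zero `a` of `f^{(j)}` with a SECOND upper zero `v ≠ a` in `‖v − Re a‖ ≤ Im a` and with
`#asc ≤ #desc + 1` on every small Jensen circle outside finitely many radii has a non-real zero of `f^{(j+1)}` in its closed Jensen disc or an NL event of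
level `j` in its closed base: `N ≥ 4` (§2) turns `#asc − #desc ≤ 1` into the count law `2(#asc − #desc) ≤ N − 2`, and part Hʼs CONVERSION concludes. -/
theorem pinning_of_netLeOne {η : ℝ} {f : ℂ → ℂ} {x₀ s hmax R Hs : ℝ} {B : ℕ} (hE : EngineHyps5 2 η f x₀ s hmax R Hs B) {j : ℕ} {a v : ℂ}
    (ha : iteratedDeriv j f a = 0) (hapos : 0 < a.im) (hv : iteratedDeriv j f v = 0) (hvpos : 0 < v.im) (hva : v ≠ a)
    (hvin : ‖v - (a.re : ℂ)‖ ≤ a.im) (hN : NetLeOne f j a) :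
    (∃ w : ℂ, iteratedDeriv (j + 1) f w = 0 ∧ w.im ≠ 0 ∧ NestedStep a w) ∨ (∃ x : ℝ, |x - a.re| ≤ a.im ∧ NLEventOf f j x) := by
  classical
  by_cases hnz : iteratedDeriv j f = 0
  · left
    refine ⟨a, ?_, hapos.ne', ?_⟩
    · rw [iteratedDeriv_succ, hnz]; simp
    · show (a.re - a.re) ^ 2 + a.im ^ 2 ≤ a.im ^ 2
      simp
  have hf : RealEntireLt2 f := realEntireLt2_of_hyps hE
  have hGd : Differentiable ℂ (iteratedDeriv j f) := differentiable_iteratedDeriv_of_entire hf.diff j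
  have hGreal : ∀ x : ℝ, (iteratedDeriv j f x).im = 0 := im_iteratedDeriv_ofReal hf.diff hf.real j
  obtain ⟨d0, hd0, E, hEfin, hnet⟩ := hN
  refine pinning_of_arcCount_cofinite hE ha hapos ⟨d0, hd0, E, hEfin, fun δ hδ => ?_⟩
  obtain ⟨hfinA, hle⟩ := hnet δ hδ
  refine ⟨hfinA, ?_⟩
  have h4 := four_le_nonrealZeroMult hGd hnz hGreal ha hapos hv hvpos hva hvin hδ.1.1
  have hle' : ((ascStarts f j a δ).ncard : ℤ) ≤ (descStarts f j a δ).ncard + 1 := by exact_mod_cast hle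
  linarith

/-! ## §4 The glued split of the residual -/

/-- An interior point of `a`ʼs closed Jensen circle region is a `NestedStep` child position. -/
theorem nestedStep_of_norm_le {a v : ℂ} (hvin : ‖v - (a.re : ℂ)‖ ≤ a.im) : NestedStep a v := by
  unfold NestedStep
  have e : ‖v - (a.re : ℂ)‖ ^ 2 = (v.re - a.re) ^ 2 + v.im ^ 2 := by
    rw [Complex.sq_norm, Complex.normSq_apply]; simp; ring
  rw [← e]
  exact pow_le_pow_left₀ (norm_nonneg _) hvin 2

/-- ★ THE ATOMIC BRANCH: the net law pays the atomic class (multiple `a` or multiple `v` ⇒ that point is itself the child). -/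
theorem pinning_of_atomic (hL : AtomicNetLawQ) {η : ℝ} {f : ℂ → ℂ} {x₀ s hmax R Hs : ℝ} {B : ℕ} (hE : EngineHyps5 2 η f x₀ s hmax R Hs B)
    {j : ℕ} {a v : ℂ} (ha : iteratedDeriv j f a = 0) (hapos : 0 < a.im) (hN : NoTallerToucher f j a) (hA : Atomic f j a v) :
    (∃ w : ℂ, iteratedDeriv (j + 1) f w = 0 ∧ w.im ≠ 0 ∧ NestedStep a w) ∨ (∃ x : ℝ, |x - a.re| ≤ a.im ∧ NLEventOf f j x) := by
  by_cases hda : iteratedDeriv (j + 1) f a = 0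
  · exact Or.inl ⟨a, hda, hapos.ne', by show (a.re - a.re) ^ 2 + a.im ^ 2 ≤ a.im ^ 2; simp⟩
  by_cases hdv : iteratedDeriv (j + 1) f v = 0
  · exact Or.inl ⟨v, hdv, hA.2.1.ne', nestedStep_of_norm_le hA.2.2.2.1⟩
  exact pinning_of_netLeOne hE ha hapos hA.1 hA.2.1 hA.2.2.1 hA.2.2.2.1 (hL η f x₀ s hmax R Hs B hE j a v ha hapos hN hA hda hdv)

/-- ★★ THE GLUED SPLIT (net form): the atomic net law and the non-atomic residual give part Iʼs residual. -/
theorem topPinningResidual_of_netSplit (hL : AtomicNetLawQ) (hR : NonAtomicTopResidualQ) : TopPinningNonNestedAscResidual := by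
  intro η f x₀ s hmax R Hs B hE j a ha hapos hN hJ hS hA hM hnest
  by_cases hat : ∃ v : ℂ, Atomic f j a v
  · obtain ⟨v, hv⟩ := hat
    exact pinning_of_atomic hL hE ha hapos hN hv
  · push Not at hat
    exact hR η f x₀ s hmax R Hs B hE j a ha hapos hN hJ hS hA hM hnest hat

/-- ★★★ THE GLUED SPLIT: `AtomicShapeLawQ → NonAtomicTopResidualQ → TopPinningNonNestedAscResidual`. -/
theorem topPinningResidual_of_split (hL : AtomicShapeLawQ) (hR : NonAtomicTopResidualQ) : TopPinningNonNestedAscResidual :=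
  topPinningResidual_of_netSplit (atomicNetLaw_of_atomicShapeLaw hL) hR

/-- … hence `TopPinning` (part I). -/
theorem topPinning_of_split (hL : AtomicShapeLawQ) (hR : NonAtomicTopResidualQ) : TopPinning :=
  topPinning_of_nonNestedAscResidual (topPinningResidual_of_split hL hR)

/-- Converse bookkeeping: the non-atomic residual is a sub-case of the law (the atomic SHAPE law is NOT — it is strictly stronger on its class). -/
theorem nonAtomicResidual_of_topPinning (hP : TopPinning) : NonAtomicTopResidualQ :=
  fun η f x₀ s hmax R Hs B hE j a ha hapos hN _ _ _ _ _ _ => hP η f x₀ s hmax R Hs B hE j a ha hapos hN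

/-- In the residual the atomic mate, when it exists, is THE mate: `¬ JensenIsolated` produces a mate and `Atomic` makes it unique. -/
theorem atomic_mate_unique {f : ℂ → ℂ} {j : ℕ} {a v : ℂ} (hA : Atomic f j a v) : ∀ c, IsMate f j a c ↔ c = v :=
  fun _ => ⟨fun hc => eq_of_isMate_of_atomic hA hc, fun h => h ▸ isMate_of_atomic hA⟩

/-! ## §5 PIN-P3: the central-child candidate for clusters `P ≥ 3` (statement only) -/

/-- ☆ CANDIDATE LAW «PIN-P3» (STATEMENT ONLY — binder of nothing; SUMMON (O7-3)).  On a legal frame, a top upper zero `a` of `f^{(j)}` with TWO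
DISTINCT INTERIOR mates `v ≠ u` (`‖v − Re a‖ ≤ Im a`, `‖u − Re a‖ ≤ Im a`; cluster size `P ≥ 3`) whose small circles are NOT net-non-ascending
(the `K < 0` proxy of the residual) has a NON-REAL zero of `f^{(j+1)}` in its CLOSED Jensen disc — the FIRST disjunct of the law, no NL escape needed.
FIRST INSTANCE (C6 g38, frame W7): `a = i`, `v = 0.55 + 0.81 i`, `u = 0.81 + 0.54 i`, no teeth, background weight `g = −12`: `#asc = 2` in the lens
`J_v` for `g ∈ (−19.46, −8.48)` (so SHAPE v2 fails there), yet the central child `w ≈ 0.0637 + 0.9882 i` of the cluster lies in `D̄_a`.  C6ʼs closed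
form for the atomic central child (`z_c = m + G − s √(G² + d²)`, `m = (a+v)/2`, `d = (a−v)/2`, `G = −1/F(m)`) is recorded in the gen-7 memo, not typed.
Why it might fail: a far exterior field (teeth / a heavy pair outside the column) can drag the clusterʼs children out of `D̄_a` while keeping `K < 0`
(no census of that regime yet). -/
def CentralChildDiscQ : Prop :=
  ∀ (η : ℝ) (f : ℂ → ℂ) (x₀ s hmax R Hs : ℝ) (B : ℕ), EngineHyps5 2 η f x₀ s hmax R Hs B → ∀ (j : ℕ) (a v u : ℂ),
    iteratedDeriv j f a = 0 → 0 < a.im → NoTallerToucher f j a → IsMate f j a v → IsMate f j a u → v ≠ u →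
    ‖v - (a.re : ℂ)‖ ≤ a.im → ‖u - (a.re : ℂ)‖ ≤ a.im → ¬ ArcNetNonAsc f j a →
    ∃ w : ℂ, iteratedDeriv (j + 1) f w = 0 ∧ w.im ≠ 0 ∧ NestedStep a w

/-- PIN-P3 pays its class inside `NonAtomicTopResidualQ` (bookkeeping only; the class with an exterior mate or an on-chain third zero is not covered). -/
theorem nonAtomic_twoInteriorMates_of_centralChild (hC : CentralChildDiscQ) {η : ℝ} {f : ℂ → ℂ} {x₀ s hmax R Hs : ℝ} {B : ℕ}
    (hE : EngineHyps5 2 η f x₀ s hmax R Hs B) {j : ℕ} {a v u : ℂ} (ha : iteratedDeriv j f a = 0) (hapos : 0 < a.im)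
    (hN : NoTallerToucher f j a) (hv : IsMate f j a v) (hu : IsMate f j a u) (hvu : v ≠ u) (hvin : ‖v - (a.re : ℂ)‖ ≤ a.im)
    (huin : ‖u - (a.re : ℂ)‖ ≤ a.im) (hM : ¬ ArcNetNonAsc f j a) :
    (∃ w : ℂ, iteratedDeriv (j + 1) f w = 0 ∧ w.im ≠ 0 ∧ NestedStep a w) ∨ (∃ x : ℝ, |x - a.re| ≤ a.im ∧ NLEventOf f j x) :=
  Or.inl (hC η f x₀ s hmax R Hs B hE j a v u ha hapos hN hv hu hvu hvin huin hM)

end RhW08.Lens1ArcSign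

-- ======== AtomicLens-v1 dcb386b07eff4002 (part K; import lines stripped) ========

/-!
# TiltedLandingLaw421R3 — lens-1 (part K): bad points live in the LENS; the FOOT ARC; ORDER ⇒ the atomic SHAPE law

LENS-1 gen-7 module image `rh33346-cover/lens-1/AtomicLens-v1.lean` (landing target `…/Theorems/TiltedLandingLaw421R3Lens1ArcSignK.lean`; imports part J
= image `lens-1/AtomicSplit-v1.lean` d20ba21dd3d75e0e until it is tree, and the tree kernel `…R3NestedSign` (`RhW08.NestedSign.exists_cofactor`,
`im_mul_im_logDeriv_nonpos`, `im_mul_normSq_of_crit`); namespace `RhW08.Lens1ArcSign`; 0 `sorry`; checked BY CHAIN `lens-1/AtomicSplitLens-v1-chain.lean`).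
SUMMON (O7-2) of director-rh g25: the ATOMIC RUNG attempt.

CONTENT. §1 lens geometry: `circleLoop_ofReal_re`, `normSq_sub_of_onCircle`, ★ `lens_mono_right` / `lens_mono_left` (membership of `D_v` is MONOTONE toward
the `v`-side foot along the circle) and `lens_initial_segment` (in `t`: for `Re a ≤ Re v` the lens `J = C ∩ D_v` meets the upper semicircle in an INITIAL
`t`-segment at the right foot) · §2 ★★ `bad_subset_lens` (PROVED, «BadInLens»): on a legal frame, if `v ≠ a` is a SIMPLE upper zero of `f^{(j)}` and every
OTHER upper zero is strictly disc-apart from `a`, then for `0 < δ < g` (the uniform far gap) every upper point `w` of the circle `|w − Re a| = Im a + δ` with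
`Im φ(w) > 0` lies in the open lens: `‖w − Re v‖ < Im v` — by global pair removal `f^{(j)} = pairQ · h`, the Jensen sign lemma for `h` (`w` is Jensen-clear
for `h`), and `Im (2(w − Re v)/pairQ(w)) · |pairQ(w)|² = 2 Im w (Im v² − ‖w − Re v‖²)`; corollary `bad_subset_lens_of_atomic` · §3 ORDER: `ArcOrder f j a δ`
(:= for bad pieces `(t₁,t₂)`, `(t₃,t₄)` with `t₂ ≤ t₃`: `Re φ(t₂) ≤ Re φ(t₃)` — C6ʼs «hi_i ≤ lo_j», tilt included, mirror-invariant), ★ `AtomicOrderLawQ`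
(OPEN), and the PROVED reduction `ascStarts_subsingleton_of_order` ⇒ `atomicShapeLaw_of_orderLaw : AtomicOrderLawQ → AtomicShapeLawQ` (two ascending
pieces `P < P′` would need `Re φ(end P) > 0 > Re φ(start P′)`), hence `topPinningResidual_of_orderSplit : AtomicOrderLawQ → NonAtomicTopResidualQ →
TopPinningNonNestedAscResidual`.

VERDICTS on C6ʼs regularities (SUMMON (O7-2); EngineHyps5 + one-mate geometry vs new input):
* BadInLens — PROVED here (frame + simplicity of `v` + far-ness of the third zeros from `a`; neither `NoTallerToucher` nor interiority is used).
* FOOT ARC — PROVED here (pure geometry: on `‖w − Re a‖ = r`, `‖w − Re v‖² = r² + (Re v − Re a)² − 2(Re v − Re a)(Re w − Re a)` is affine decreasing in `Re w`).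
* ORDER — NEEDS NEW INPUT: the nodal-domain topology of `Im φ` inside `D_a` (C6 g37 §2.6 Proposition: the negative tongue between two pieces (i) meets `C_a`
  only along the gap and (ii) carries no real zero of `f^{(j)}` on its boundary; then `Re φ` increases along the sealing arc by Cauchy–Riemann).  Why it might
  fail: a tooth on the tongueʼs boundary flips `Re φ` from `+∞` to `−∞`, or the tongue reaches a second arc; census 0 / 5 845 two-piece + 0 / 247 360 adversarial
  tooth insertions (g37), 174/174 + 75/75 (g38), never refuted, unproved.
* (S*a) «≤ 2 pieces in J, the first at the foot» — NEEDS NEW INPUT: a zero-count for the one-variable function `K_{k,m}(c)` on `J` (convexity trick of C6ʼs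
  Theorem A covers backgrounds (k teeth, 0 pairs) on the exact circle; one exterior pair = cubic; ≥ 2 pairs open).  Why it might fail: a third piece for two
  exterior pairs + teeth (0 in 522 885, not adversarially climbed for three pieces); NOT needed once ORDER holds.
* (S*b) «foot piece and hump never ascend together» — ⟸ ORDER (disjoint tilt windows); nothing separate to prove.
LARGEST PROVABLE SUB-CLASS NOW: none beyond the trivial ones inside EngineHyps5 (Theorem Aʼs class «no exterior pair at all» is a statement about toy
products `e^{gz}·poly`, whose transversality-in-δ step is configuration-wise; typing it as a frame sub-class buys no registry row) — recorded, not typed.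

HONEST LABEL: two lemmas and one reduction; `AtomicOrderLawQ`, `AtomicShapeLawQ`, `NonAtomicTopResidualQ`, `TopPinning`, 33346, 33347 OPEN; nothing here bears
on the truth of RH; RH is not proved; checked ≠ landed ≠ proved.
-/

noncomputable section

namespace RhW08.Lens1ArcSign

open Complex Set Metric Filter Topology
open scoped Real ComplexConjugate
open Literature.Topology.PlaneTopology Literature.Analysis.Complex
open Summit.RiemannHypothesis.RiemannHypothesis.Theorems.Splittings.JensenWindow
open RhIdea6.G17.W07C7 RhIdea6.G17.W07C7.Rev6 RhIdea6.G18.W07C8.Law421BirthS RhIdea6.G19.W07C11.Seam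
open RhIdea6.G20.W07C12.Frac RhIdea6.G20.W07C12.StColP RhW07.C12.FieldSplit RhIdea6.G21.W07C13.TentMax
open RhW07.C14.TwoSided RhW07.C14.Classes RhW07.C14.Lineage RhW07.C14.Booking
open RhW07.C13.Heredity RhIdea6.G22.W07C15pre.Injection RhW07.E3.Cell RhW07.E3.Lit
open RhW08.Round1 RhW08.StSwap RhW08.Round2 RhW08.QuadW RhW08.SealSwapQ RhW08.SealSwap RhW08.SuccB RhW08.SuccSplit
open RhW08.SuccTheft RhW08.Column RhW08.Hurwitz RhW08.ClusterQ RhW08.ClusterQM RhW08.NewtonDoor RhW08.NewtonDoorGenusOne RhW08.PurseP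
open RhW08.Lens1SignCut RhW08.Lens1Coverage RhW08.IsolatedTilt RhW08.Lens1Pinning RhW08.Lens1PinningIso

/-! ## §1 Geometry of the lens `J = C ∩ D_v` -/

/-- `Re` along the circle loop of real centre `c`: `c + r cos 2πt`. -/
theorem circleLoop_ofReal_re (c r t : ℝ) : (circleLoop (c : ℂ) r t).re = c + r * Real.cos (2 * π * t) := by
  have e : (2 * ↑π * ↑t * I : ℂ) = ((2 * π * t : ℝ) : ℂ) * I := by push_cast; ring
  rw [circleLoop_apply, e, add_re, ofReal_re, re_ofReal_mul, exp_ofReal_mul_I_re]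

/-- On the circle `‖w − p‖ = r`: `‖w − x‖² = r² + (x − p)² − 2(x − p)(Re w − p)` — AFFINE and, for `x ≥ p`, DECREASING in `Re w`. -/
theorem normSq_sub_of_onCircle {w : ℂ} {p r : ℝ} (x : ℝ) (hw : ‖w - (p : ℂ)‖ = r) :
    ‖w - (x : ℂ)‖ ^ 2 = r ^ 2 + (x - p) ^ 2 - 2 * (x - p) * (w.re - p) := by
  have e1 : ‖w - (p : ℂ)‖ ^ 2 = (w.re - p) ^ 2 + w.im ^ 2 := by rw [Complex.sq_norm, Complex.normSq_apply]; simp; ring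
  have e2 : ‖w - (x : ℂ)‖ ^ 2 = (w.re - x) ^ 2 + w.im ^ 2 := by rw [Complex.sq_norm, Complex.normSq_apply]; simp; ring
  rw [hw] at e1
  rw [e2, e1]
  ring

/-- ★ FOOT ARC, `v` on the right (`p ≤ x`): membership of the open lens `‖· − x‖ < y` is monotone toward the RIGHT foot along the circle. -/
theorem lens_mono_right {w w' : ℂ} {p r x y : ℝ} (hw : ‖w - (p : ℂ)‖ = r) (hw' : ‖w' - (p : ℂ)‖ = r) (hpx : p ≤ x) (hre : w.re ≤ w'.re)
    (hin : ‖w - (x : ℂ)‖ < y) : ‖w' - (x : ℂ)‖ < y := by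
  have h1 := normSq_sub_of_onCircle x hw
  have h2 := normSq_sub_of_onCircle x hw'
  have hle : ‖w' - (x : ℂ)‖ ^ 2 ≤ ‖w - (x : ℂ)‖ ^ 2 := by rw [h1, h2]; nlinarith
  exact ((pow_le_pow_iff_left₀ (norm_nonneg _) (norm_nonneg _) two_ne_zero).1 hle).trans_lt hin

/-- FOOT ARC, `v` on the left (`x ≤ p`): monotone toward the LEFT foot. -/
theorem lens_mono_left {w w' : ℂ} {p r x y : ℝ} (hw : ‖w - (p : ℂ)‖ = r) (hw' : ‖w' - (p : ℂ)‖ = r) (hxp : x ≤ p) (hre : w'.re ≤ w.re)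
    (hin : ‖w - (x : ℂ)‖ < y) : ‖w' - (x : ℂ)‖ < y := by
  have h1 := normSq_sub_of_onCircle x hw
  have h2 := normSq_sub_of_onCircle x hw'
  have hle : ‖w' - (x : ℂ)‖ ^ 2 ≤ ‖w - (x : ℂ)‖ ^ 2 := by rw [h1, h2]; nlinarith
  exact ((pow_le_pow_iff_left₀ (norm_nonneg _) (norm_nonneg _) two_ne_zero).1 hle).trans_lt hin

/-- ★ In the parameter `t` (`v` on the right, `Re a ≤ Re v`): the lens meets the upper semicircle `t ∈ [0, ½]` in an INITIAL segment at the right foot. -/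
theorem lens_initial_segment {a v : ℂ} {δ t t' : ℝ} (hr : 0 ≤ a.im + δ) (hav : a.re ≤ v.re) (ht : 0 ≤ t) (htt' : t ≤ t') (ht' : t' ≤ 1 / 2)
    (hin : ‖circleLoop (a.re : ℂ) (a.im + δ) t' - (v.re : ℂ)‖ < v.im) : ‖circleLoop (a.re : ℂ) (a.im + δ) t - (v.re : ℂ)‖ < v.im := by
  have hγ : ∀ s : ℝ, ‖circleLoop (a.re : ℂ) (a.im + δ) s - (a.re : ℂ)‖ = a.im + δ := fun s => by
    rw [norm_circleLoop_sub_center, abs_of_nonneg hr]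
  refine lens_mono_right (hγ t') (hγ t) hav ?_ hin
  rw [circleLoop_ofReal_re, circleLoop_ofReal_re]
  have hcos : Real.cos (2 * π * t') ≤ Real.cos (2 * π * t) :=
    Real.cos_le_cos_of_nonneg_of_le_pi (by positivity) (by nlinarith [Real.pi_pos]) (by nlinarith [Real.pi_pos])
  nlinarith [mul_le_mul_of_nonneg_left hcos hr]

/-- The mirror statement (`Re v ≤ Re a`): a FINAL segment at the left foot. -/
theorem lens_final_segment {a v : ℂ} {δ t t' : ℝ} (hr : 0 ≤ a.im + δ) (hva : v.re ≤ a.re) (ht : 0 ≤ t) (htt' : t ≤ t') (ht' : t' ≤ 1 / 2)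
    (hin : ‖circleLoop (a.re : ℂ) (a.im + δ) t - (v.re : ℂ)‖ < v.im) : ‖circleLoop (a.re : ℂ) (a.im + δ) t' - (v.re : ℂ)‖ < v.im := by
  have hγ : ∀ s : ℝ, ‖circleLoop (a.re : ℂ) (a.im + δ) s - (a.re : ℂ)‖ = a.im + δ := fun s => by
    rw [norm_circleLoop_sub_center, abs_of_nonneg hr]
  refine lens_mono_left (hγ t) (hγ t') hva ?_ hin
  rw [circleLoop_ofReal_re, circleLoop_ofReal_re]
  have hcos : Real.cos (2 * π * t') ≤ Real.cos (2 * π * t) :=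
    Real.cos_le_cos_of_nonneg_of_le_pi (by positivity) (by nlinarith [Real.pi_pos]) (by nlinarith [Real.pi_pos])
  nlinarith [mul_le_mul_of_nonneg_left hcos hr]

/-! ## §2 BadInLens: every bad point of a small circle lies in the open lens -/

/-- The uniform far gap keeps every point of the circle of radius `Im a + δ`, `δ < g`, Jensen-clear of a far zero `c`. -/
theorem im_lt_norm_sub_of_gap {a c w : ℂ} {δ g : ℝ} (hw : ‖w - (a.re : ℂ)‖ = a.im + δ) (hδg : δ < g)
    (hgap : a.im + |c.im| + g ≤ |a.re - c.re|) : |c.im| < ‖w - (c.re : ℂ)‖ := by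
  have h1 : |w.re - c.re| ≤ ‖w - (c.re : ℂ)‖ := by
    have := abs_re_le_norm (w - (c.re : ℂ)); rwa [sub_re, ofReal_re] at this
  have h2 : |w.re - a.re| ≤ a.im + δ := by
    have := abs_re_le_norm (w - (a.re : ℂ)); rw [sub_re, ofReal_re, hw] at this; exact this
  have h3 : |a.re - c.re| ≤ |a.re - w.re| + |w.re - c.re| := abs_sub_le a.re w.re c.re
  rw [abs_sub_comm a.re w.re] at h3
  linarith

set_option maxHeartbeats 800000 in
/-- ★★ BadInLens (PROVED).  Legal frame; `v ≠ a` a SIMPLE upper zero of `f^{(j)}`; every other upper zero strictly disc-apart from `a`.  Then for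
`0 < δ < g` every upper point `w` of the circle `|w − Re a| = Im a + δ` with `Im φ(w) > 0` lies in the open lens `‖w − Re v‖ < Im v`. -/
theorem bad_subset_lens {η : ℝ} {f : ℂ → ℂ} {x₀ s hmax R Hs : ℝ} {B : ℕ} (hE : EngineHyps5 2 η f x₀ s hmax R Hs B) {j : ℕ} {a v : ℂ}
    (ha : iteratedDeriv j f a = 0) (hapos : 0 < a.im) (hv : iteratedDeriv j f v = 0) (hvpos : 0 < v.im)
    (hvs : iteratedDeriv (j + 1) f v ≠ 0)
    (hfar : ∀ c : ℂ, iteratedDeriv j f c = 0 → 0 < c.im → c ≠ a → c ≠ v → a.im + c.im < |a.re - c.re|) :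
    ∃ g > 0, ∀ δ ∈ Ioo 0 g, ∀ t : ℝ, 0 < (circleLoop (a.re : ℂ) (a.im + δ) t).im → 0 < (arcPhi f j a δ t).im →
      ‖circleLoop (a.re : ℂ) (a.im + δ) t - (v.re : ℂ)‖ < v.im := by
  classical
  have hf : RealEntireLt2 f := realEntireLt2_of_hyps hE
  set G : ℂ → ℂ := iteratedDeriv j f with hGdef
  have hG : RealEntireLt2 G := RhW08.WindowLoss.realEntireLt2_iteratedDeriv hf j
  have e1 : deriv G = iteratedDeriv (j + 1) f := by rw [hGdef, ← iteratedDeriv_succ]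
  have hnz : G ≠ 0 := by
    intro h0
    apply hvs
    rw [← e1, h0]; simp
  have hstrip : ∀ c : ℂ, G c = 0 → |c.im| ≤ Hs := fun c hc => abs_im_le_of_level hE hnz hc
  have haHs : a.im ≤ Hs := by have := hstrip a ha; rwa [abs_of_pos hapos] at this
  obtain ⟨g, hg0, -, hgap⟩ := exists_uniform_far_gap hG.diff hnz hstrip hapos haHs
  -- global pair removal `G = pairQ · h`, `h(v) ≠ 0` by simplicity
  obtain ⟨h, hhd, ⟨ρ, C, hρ0, hρ, hgr⟩, hreal, hfac⟩ := RhW08.NestedSign.exists_cofactor hG hv hvpos.ne'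
  have hderiv : ∀ z, deriv G z = 2 * (z - v.re) * h z + pairQ v.re v.im z * deriv h z := by
    intro z
    have e : G = pairQ v.re v.im * h := funext fun u => by rw [Pi.mul_apply]; exact hfac u
    have hq : HasDerivAt (pairQ v.re v.im) (2 * (z - v.re)) z := RhW07.Law421.SuccessorCertificate.hasDerivAt_quadP v.re v.im z
    have hp := hq.mul (hhd z).hasDerivAt
    rw [e, hp.deriv]
  have hqv : pairQ v.re v.im v = 0 := by
    have e : v - (v.re : ℂ) = (v.im : ℂ) * I := by apply Complex.ext <;> simp
    rw [pairQ, e, mul_pow, Complex.I_sq]; ring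
  have hhv : h v ≠ 0 := by
    intro h0
    apply hvs
    rw [← e1, hderiv v, h0, hqv]; simp
  have hhvbar : h (conj v) ≠ 0 := by rw [apply_conj_eq_conj hhd hreal, map_ne_zero]; exact hhv
  refine ⟨g, hg0, fun δ hδ t hwim hφ => ?_⟩
  set w : ℂ := circleLoop (a.re : ℂ) (a.im + δ) t with hwdef
  have hr : 0 < a.im + δ := by linarith [hδ.1]
  have hw : ‖w - (a.re : ℂ)‖ = a.im + δ := by rw [hwdef, norm_circleLoop_sub_center, abs_of_pos hr]
  have hφdef : arcPhi f j a δ t = deriv G w / G w := rfl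
  have hGw : G w ≠ 0 := by
    intro h0
    rw [hφdef, h0, div_zero] at hφ
    simp at hφ
  have hqw : pairQ v.re v.im w ≠ 0 := by
    intro h0; apply hGw; rw [hfac w, h0, zero_mul]
  have hhw : h w ≠ 0 := by
    intro h0; apply hGw; rw [hfac w, h0, mul_zero]
  -- `w` is Jensen-clear for `h`
  have hout : ∀ z, h z = 0 → |z.im| < ‖w - (z.re : ℂ)‖ := by
    intro z hz
    have hGz : G z = 0 := by rw [hfac z, hz, mul_zero]
    have hzv : z ≠ v := by rintro rfl; exact hhv hz
    have hzvbar : z ≠ conj v := by rintro rfl; exact hhvbar hz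
    rcases lt_trichotomy z.im 0 with hneg | hzero | hposz
    · have hGc : G (conj z) = 0 := by rw [apply_conj_eq_conj hG.diff hG.real, hGz, map_zero]
      have hcim : 0 < (conj z).im := by rw [Complex.conj_im]; linarith
      have hcre : (conj z).re = z.re := Complex.conj_re z
      have habs : |(conj z).im| = |z.im| := by rw [Complex.conj_im, abs_neg]
      by_cases hca : conj z = a
      · have e2 : z.re = a.re := by rw [← hcre, hca]
        have e3 : |z.im| = a.im := by rw [← habs, hca, abs_of_pos hapos]
        rw [e2, e3, hw]
        linarith [hδ.1]
      · have hcv : conj z ≠ v := fun e => hzvbar (by rw [← e, Complex.conj_conj])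
        have hlt := hfar (conj z) hGc hcim hca hcv
        have hgap' := hgap (conj z) hGc (by rwa [abs_of_pos hcim])
        have := im_lt_norm_sub_of_gap hw hδ.2 hgap'
        rwa [habs, hcre] at this
    · rw [hzero, abs_zero]
      have h1 : |w.im| ≤ ‖w - (z.re : ℂ)‖ := by
        have := abs_im_le_norm (w - (z.re : ℂ)); rwa [sub_im, ofReal_im, sub_zero] at this
      rw [abs_of_pos hwim] at h1
      linarith
    · by_cases hza : z = a
      · rw [hza, hw, abs_of_pos hapos]
        linarith [hδ.1]
      · have hlt := hfar z hGz hposz hza hzv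
        have hgap' := hgap z hGz (by rwa [abs_of_pos hposz])
        exact im_lt_norm_sub_of_gap hw hδ.2 hgap'
  -- Jensen sign lemma for the cofactor
  have hsign := RhW08.NestedSign.im_mul_im_logDeriv_nonpos hhd hρ0 hρ hgr hreal hhw hout
  have hKh : (deriv h w / h w).im ≤ 0 := by
    by_contra hp
    push Not at hp
    have := mul_pos hwim hp
    linarith
  -- `φ = 2(w − Re v)/pairQ(w) + h′/h(w)`, so the pair term has positive imaginary part
  have hφeq : arcPhi f j a δ t = 2 * (w - v.re) / pairQ v.re v.im w + deriv h w / h w := by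
    rw [hφdef, hderiv w, hfac w]
    field_simp
  have hpair : 0 < (2 * (w - v.re) / pairQ v.re v.im w).im := by
    have : (arcPhi f j a δ t).im = (2 * (w - v.re) / pairQ v.re v.im w).im + (deriv h w / h w).im := by rw [hφeq, add_im]
    linarith
  -- ⇒ `w ∈ D_v`
  set K : ℂ := -(2 * (w - v.re) / pairQ v.re v.im w) with hK
  have hcrit : pairQ v.re v.im w * K = -(2 * (w - v.re)) := by
    rw [hK, mul_neg, mul_div_cancel₀ _ hqw]
  have hid := RhW08.NestedSign.im_mul_normSq_of_crit hvpos.ne' hcrit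
  have hKim : K.im < 0 := by rw [hK, neg_im]; linarith
  have hprod : K.im * Complex.normSq (pairQ v.re v.im w) < 0 := mul_neg_of_neg_of_pos hKim (Complex.normSq_pos.2 hqw)
  rw [hid] at hprod
  have h2 : 0 < 2 * w.im * (v.im ^ 2 - ((w.re - v.re) ^ 2 + w.im ^ 2)) := by linarith
  have hsq : (w.re - v.re) ^ 2 + w.im ^ 2 < v.im ^ 2 := by
    have := (mul_pos_iff_of_pos_left (by linarith : (0 : ℝ) < 2 * w.im)).1 h2
    linarith
  have e : ‖w - (v.re : ℂ)‖ ^ 2 = (w.re - v.re) ^ 2 + w.im ^ 2 := by rw [Complex.sq_norm, Complex.normSq_apply]; simp; ring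
  exact (pow_lt_pow_iff_left₀ (norm_nonneg _) hvpos.le two_ne_zero).1 (by rw [e]; exact hsq)

/-- ★ BadInLens on the ATOMIC class (part Jʼs `Atomic`; only its zero / positivity / off-chain-from-`a` clauses are used). -/
theorem bad_subset_lens_of_atomic {η : ℝ} {f : ℂ → ℂ} {x₀ s hmax R Hs : ℝ} {B : ℕ} (hE : EngineHyps5 2 η f x₀ s hmax R Hs B) {j : ℕ}
    {a v : ℂ} (ha : iteratedDeriv j f a = 0) (hapos : 0 < a.im) (hA : Atomic f j a v) (hvs : iteratedDeriv (j + 1) f v ≠ 0) :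
    ∃ g > 0, ∀ δ ∈ Ioo 0 g, ∀ t : ℝ, 0 < (circleLoop (a.re : ℂ) (a.im + δ) t).im → 0 < (arcPhi f j a δ t).im →
      ‖circleLoop (a.re : ℂ) (a.im + δ) t - (v.re : ℂ)‖ < v.im :=
  bad_subset_lens hE ha hapos hA.1 hA.2.1 hvs fun c hc hcpos hca hcv => (hA.2.2.2.2.2 c hc hcpos hca hcv).1

/-! ## §3 ORDER and the reduction ORDER ⇒ SHAPE -/

/-- ORDER at radius excess `δ` (C6 g37 §2.6 «hi_i ≤ lo_j», tilt included): for bad pieces `(t₁,t₂)`, `(t₃,t₄)` of the upper semicircle with `t₂ ≤ t₃`,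
`Re φ(t₂) ≤ Re φ(t₃)` — the `Re φ`-values at the piece ends are ordered along the semicircle.  Mirror-invariant (`t ↦ ½ − t`, `Re φ ↦ −Re φ`). -/
def ArcOrder (f : ℂ → ℂ) (j : ℕ) (a : ℂ) (δ : ℝ) : Prop :=
  ∀ t₁ t₂ t₃ t₄ : ℝ, BadPiece f j a δ t₁ t₂ → BadPiece f j a δ t₃ t₄ → t₂ ≤ t₃ → (arcPhi f j a δ t₂).re ≤ (arcPhi f j a δ t₃).re

/-- ★ THE ATOMIC ORDER LAW (OPEN; NEEDS NEW INPUT — nodal topology (i)/(ii); census 0 / 5 845, 174/174): on a legal frame, a top upper zero `a` with an atomic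
mate `v`, both simple, has ORDERED piece ends on every small Jensen circle outside finitely many radii. -/
def AtomicOrderLawQ : Prop :=
  ∀ (η : ℝ) (f : ℂ → ℂ) (x₀ s hmax R Hs : ℝ) (B : ℕ), EngineHyps5 2 η f x₀ s hmax R Hs B → ∀ (j : ℕ) (a v : ℂ),
    iteratedDeriv j f a = 0 → 0 < a.im → NoTallerToucher f j a → Atomic f j a v →
    iteratedDeriv (j + 1) f a ≠ 0 → iteratedDeriv (j + 1) f v ≠ 0 → ∃ d0 > 0, ∃ E : Set ℝ, E.Finite ∧ ∀ δ ∈ Ioo 0 d0 \ E, ArcOrder f j a δ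

/-- ★ ORDER ⇒ at most ONE ascending bad piece (two ascending pieces `P < P′` would give `Re φ(end P) > 0 > Re φ(start P′)`, against ORDER). -/
theorem ascStarts_subsingleton_of_order {f : ℂ → ℂ} {j : ℕ} {a : ℂ} {δ : ℝ} (hO : ArcOrder f j a δ) : (ascStarts f j a δ).Subsingleton := by
  intro t₁ ht₁ t₁' ht₁'
  obtain ⟨t₂, hP, hre1, hre2⟩ := ht₁
  obtain ⟨t₂', hP', hre1', hre2'⟩ := ht₁'
  by_contra hne
  rcases lt_or_gt_of_ne hne with hlt | hlt
  · have h23 : t₂ ≤ t₁' := by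
      by_contra hgt
      push Not at hgt
      have := hP.2.2.2.1 t₁' ⟨hlt, hgt⟩
      linarith [hP'.2.2.2.2.1]
    have := hO t₁ t₂ t₁' t₂' hP hP' h23
    linarith
  · have h23 : t₂' ≤ t₁ := by
      by_contra hgt
      push Not at hgt
      have := hP'.2.2.2.1 t₁ ⟨hlt, hgt⟩
      linarith [hP.2.2.2.2.1]
    have := hO t₁' t₂' t₁ t₂ hP' hP h23
    linarith

/-- A subsingleton set of reals is finite with `ncard ≤ 1`. -/
theorem finite_and_ncard_le_one {S : Set ℝ} (hS : S.Subsingleton) : S.Finite ∧ S.ncard ≤ 1 := by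
  refine ⟨hS.finite, ?_⟩
  rcases hS.eq_empty_or_singleton with h | ⟨x, h⟩
  · rw [h, Set.ncard_empty]; exact zero_le_one
  · rw [h, Set.ncard_singleton]

/-- ORDER on the small circles ⇒ `AscLeOne`. -/
theorem ascLeOne_of_order {f : ℂ → ℂ} {j : ℕ} {a : ℂ} (h : ∃ d0 > 0, ∃ E : Set ℝ, E.Finite ∧ ∀ δ ∈ Ioo 0 d0 \ E, ArcOrder f j a δ) :
    AscLeOne f j a := by
  obtain ⟨d0, hd0, E, hE, hO⟩ := h
  exact ⟨d0, hd0, E, hE, fun δ hδ => finite_and_ncard_le_one (ascStarts_subsingleton_of_order (hO δ hδ))⟩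

/-- ★★ THE REDUCTION: the atomic ORDER law gives the atomic SHAPE law. -/
theorem atomicShapeLaw_of_orderLaw (hO : AtomicOrderLawQ) : AtomicShapeLawQ :=
  fun η f x₀ s hmax R Hs B hE j a v ha hapos hN hA hda hdv => ascLeOne_of_order (hO η f x₀ s hmax R Hs B hE j a v ha hapos hN hA hda hdv)

/-- … hence ORDER + the non-atomic residual give part Iʼs residual (via part Jʼs split) … -/
theorem topPinningResidual_of_orderSplit (hO : AtomicOrderLawQ) (hR : NonAtomicTopResidualQ) : TopPinningNonNestedAscResidual :=
  topPinningResidual_of_split (atomicShapeLaw_of_orderLaw hO) hR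

/-- … and `TopPinning`. -/
theorem topPinning_of_orderSplit (hO : AtomicOrderLawQ) (hR : NonAtomicTopResidualQ) : TopPinning :=
  topPinning_of_split (atomicShapeLaw_of_orderLaw hO) hR

end RhW08.Lens1ArcSign

-- ======== AtomicGapOrder-v1 (part L; import lines stripped) ========

/-!
# TiltedLandingLaw421R3 — lens-1 (part L): GAP ORDER (consecutive pieces only) ⇒ the atomic NET law

LENS-1 gen-7 module image `rh33346-cover/lens-1/AtomicGapOrder-v1.lean` (landing target `…/Theorems/TiltedLandingLaw421R3Lens1ArcSignL.lean`; ONE import = part K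
`…R3Lens1ArcSignK` = image `lens-1/AtomicLens-v1.lean` dcb386b07eff4002 until it is tree; namespace `RhW08.Lens1ArcSign`; 0 `sorry`; checked BY CHAIN
`lens-1/AtomicGapOrder-v1-chain.lean` over the tree parts A–I + `…R3NestedSign`).

WHY THIS FILE.  C6ʼs mechanism for ORDER (g37 §2.6: walk the boundary of the negative tongue from the end of one bad piece to the start of the NEXT one;
`Re φ` increases along the sealing nodal arc by Cauchy–Riemann) proves the order relation for CONSECUTIVE pieces only.  Part Kʼs `ArcOrder` asks it for ALL
pairs (what the census verified), which is more than the mechanism gives.  Here the typed law is weakened to exactly the mechanismʼs output — ★ `ArcGapOrder`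
(«hi_i ≤ lo_{i+1}»: pieces with no bad point between them) — and the payment is re-proved at that level: consecutive order no longer forces `#asc ≤ 1`
(asc, desc, asc is allowed) but it DOES force the NET count `#asc ≤ #desc + 1`, which is what part Jʼs split consumes (`topPinningResidual_of_netSplit`).

CONTENT. §1 `ArcGapOrder`, `arcGapOrder_of_arcOrder`, ★ `AtomicGapOrderLawQ` (OPEN; ⟸ `AtomicOrderLawQ`) · §2 piece combinatorics at a fixed radius:
`badPiece_end_unique`, `badPiece_le_of_lt`, ★ `exists_badPiece_around` (with finitely many real points, a positive point between two real points lies in a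
bad piece between them), ★★ `exists_desc_between` (FIRST-DROP LEMMA: under gap order, strictly between two ascending pieces there is a descending one —
the gap steps `hi_k → lo_{k+1}` never decrease, so the sign of `Re φ` can fall from `+` to `−` only INSIDE a piece), ★★ `netCount_of_gapOrder` (injection
`s ↦ first descending start after s` on the ascending starts minus the last ⇒ `#asc ≤ #desc + 1`) · §3 the generic radius: `netLeOne_of_gapOrder` (finitely
many radii carry a zero of `f^{(j)}` or `f^{(j+1)}`; off them part Dʼs `breaks_finite_or_flat` applies) ⇒ ★★ `atomicNetLaw_of_gapOrderLaw :
AtomicGapOrderLawQ → AtomicNetLawQ` ⇒ `topPinningResidual_of_gapOrderSplit : AtomicGapOrderLawQ → NonAtomicTopResidualQ → TopPinningNonNestedAscResidual`.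

THE ATOMIC LADDER (all arrows PROVED, all laws OPEN):  `AtomicOrderLawQ ⟹ AtomicGapOrderLawQ ⟹ AtomicNetLawQ ⟹(RUNG 4) law on the atomic class`, and
`AtomicOrderLawQ ⟹ AtomicShapeLawQ ⟹ AtomicNetLawQ`.  The weakest typed sufficient statement with a named mechanism is `AtomicGapOrderLawQ`.

HONEST LABEL: combinatorics + one reduction; every law named here, `TopPinning`, 33346, 33347 OPEN; nothing here bears on the truth of RH; RH is not proved;
checked ≠ landed ≠ proved.
-/

noncomputable section

namespace RhW08.Lens1ArcSign

open Complex Set Metric Filter Topology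
open scoped Real ComplexConjugate
open Literature.Topology.PlaneTopology Literature.Analysis.Complex
open Summit.RiemannHypothesis.RiemannHypothesis.Theorems.Splittings.JensenWindow
open RhIdea6.G17.W07C7 RhIdea6.G17.W07C7.Rev6 RhIdea6.G18.W07C8.Law421BirthS RhIdea6.G19.W07C11.Seam
open RhIdea6.G20.W07C12.Frac RhIdea6.G20.W07C12.StColP RhW07.C12.FieldSplit RhIdea6.G21.W07C13.TentMax
open RhW07.C14.TwoSided RhW07.C14.Classes RhW07.C14.Lineage RhW07.C14.Booking
open RhW07.C13.Heredity RhIdea6.G22.W07C15pre.Injection RhW07.E3.Cell RhW07.E3.Lit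
open RhW08.Round1 RhW08.StSwap RhW08.Round2 RhW08.QuadW RhW08.SealSwapQ RhW08.SealSwap RhW08.SuccB RhW08.SuccSplit
open RhW08.SuccTheft RhW08.Column RhW08.Hurwitz RhW08.ClusterQ RhW08.ClusterQM RhW08.NewtonDoor RhW08.NewtonDoorGenusOne RhW08.PurseP
open RhW08.Lens1SignCut RhW08.Lens1Coverage RhW08.IsolatedTilt RhW08.Lens1Pinning RhW08.Lens1PinningIso

/-! ## §1 Gap order -/

/-- ★ GAP ORDER at radius excess `δ` (the CONSECUTIVE form of part Kʼs `ArcOrder`; C6 g37 §2.6 «hi_i ≤ lo_{i+1}»): for bad pieces `(t₁,t₂)`, `(t₃,t₄)`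
with `t₂ ≤ t₃` and NO bad point between them (`Im φ ≤ 0` on `[t₂, t₃]`), `Re φ(t₂) ≤ Re φ(t₃)`. -/
def ArcGapOrder (f : ℂ → ℂ) (j : ℕ) (a : ℂ) (δ : ℝ) : Prop :=
  ∀ t₁ t₂ t₃ t₄ : ℝ, BadPiece f j a δ t₁ t₂ → BadPiece f j a δ t₃ t₄ → t₂ ≤ t₃ →
    (∀ t ∈ Icc t₂ t₃, (arcPhi f j a δ t).im ≤ 0) → (arcPhi f j a δ t₂).re ≤ (arcPhi f j a δ t₃).re

/-- All-pairs order implies gap order. -/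
theorem arcGapOrder_of_arcOrder {f : ℂ → ℂ} {j : ℕ} {a : ℂ} {δ : ℝ} (h : ArcOrder f j a δ) : ArcGapOrder f j a δ :=
  fun t₁ t₂ t₃ t₄ h₁ h₂ h23 _ => h t₁ t₂ t₃ t₄ h₁ h₂ h23

/-- ★ THE ATOMIC GAP-ORDER LAW (OPEN; NEEDS NEW INPUT — nodal topology (i)/(ii) of C6 g37 §2.6; census as for ORDER): on a legal frame, a top upper zero
`a` with an atomic mate `v`, both simple, has GAP-ORDERED consecutive pieces on every small Jensen circle outside finitely many radii. -/
def AtomicGapOrderLawQ : Prop :=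
  ∀ (η : ℝ) (f : ℂ → ℂ) (x₀ s hmax R Hs : ℝ) (B : ℕ), EngineHyps5 2 η f x₀ s hmax R Hs B → ∀ (j : ℕ) (a v : ℂ),
    iteratedDeriv j f a = 0 → 0 < a.im → NoTallerToucher f j a → Atomic f j a v →
    iteratedDeriv (j + 1) f a ≠ 0 → iteratedDeriv (j + 1) f v ≠ 0 → ∃ d0 > 0, ∃ E : Set ℝ, E.Finite ∧ ∀ δ ∈ Ioo 0 d0 \ E, ArcGapOrder f j a δ

/-- ORDER ⇒ GAP ORDER at law level. -/
theorem atomicGapOrderLaw_of_orderLaw (h : AtomicOrderLawQ) : AtomicGapOrderLawQ := by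
  intro η f x₀ s hmax R Hs B hE j a v ha hapos hN hA hda hdv
  obtain ⟨d0, hd0, E, hEfin, hO⟩ := h η f x₀ s hmax R Hs B hE j a v ha hapos hN hA hda hdv
  exact ⟨d0, hd0, E, hEfin, fun δ hδ => arcGapOrder_of_arcOrder (hO δ hδ)⟩

/-! ## §2 Piece combinatorics at a fixed radius -/

section Pieces

variable {f : ℂ → ℂ} {j : ℕ} {a : ℂ} {δ : ℝ}

/-- The later end of a bad piece is determined by the earlier one. -/
theorem badPiece_end_unique {t₁ t₂ t₂' : ℝ} (h : BadPiece f j a δ t₁ t₂) (h' : BadPiece f j a δ t₁ t₂') : t₂ = t₂' := by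
  by_contra hne
  rcases lt_or_gt_of_ne hne with hlt | hlt
  · have := h'.2.2.2.1 t₂ ⟨h.2.1, hlt⟩
    linarith [h.2.2.2.2.2]
  · have := h.2.2.2.1 t₂' ⟨h'.2.1, hlt⟩
    linarith [h'.2.2.2.2.2]

/-- Bad pieces do not overlap: a piece starting later starts after the earlier one ends. -/
theorem badPiece_le_of_lt {t₁ t₂ t₃ t₄ : ℝ} (h : BadPiece f j a δ t₁ t₂) (h' : BadPiece f j a δ t₃ t₄) (hlt : t₁ < t₃) : t₂ ≤ t₃ := by
  by_contra hgt
  push Not at hgt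
  have := h.2.2.2.1 t₃ ⟨hlt, hgt⟩
  linarith [h'.2.2.2.2.1]

/-- ★ With finitely many real points on `[0, ½]` and `Im φ` continuous there: a point `t` with `Im φ(t) > 0` lying between two real points `r < t < p`
lies inside a bad piece `(u, w)` with `r ≤ u < t < w ≤ p` (the maximal positivity interval around `t`). -/
theorem exists_badPiece_around (hfin : {t : ℝ | t ∈ Icc (0 : ℝ) (1 / 2) ∧ (arcPhi f j a δ t).im = 0}.Finite)
    (hcont : ContinuousOn (fun t => (arcPhi f j a δ t).im) (Icc 0 (1 / 2))) {r p t : ℝ} (hr0 : 0 ≤ r)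
    (hrim : (arcPhi f j a δ r).im = 0) (hp : p ≤ 1 / 2) (hpim : (arcPhi f j a δ p).im = 0) (hrt : r < t) (htp : t < p)
    (ht : 0 < (arcPhi f j a δ t).im) : ∃ u w : ℝ, BadPiece f j a δ u w ∧ r ≤ u ∧ u < t ∧ t < w ∧ w ≤ p := by
  classical
  set Zl : Set ℝ := {z | (z ∈ Icc (0 : ℝ) (1 / 2) ∧ (arcPhi f j a δ z).im = 0) ∧ z < t} with hZl
  set Zr : Set ℝ := {z | (z ∈ Icc (0 : ℝ) (1 / 2) ∧ (arcPhi f j a δ z).im = 0) ∧ t < z} with hZr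
  have hZlfin : Zl.Finite := hfin.subset fun z hz => hz.1
  have hZrfin : Zr.Finite := hfin.subset fun z hz => hz.1
  have hrZ : r ∈ Zl := ⟨⟨⟨hr0, by linarith⟩, hrim⟩, hrt⟩
  have hpZ : p ∈ Zr := ⟨⟨⟨by linarith, hp⟩, hpim⟩, htp⟩
  have huZ : sSup Zl ∈ Zl := Set.Nonempty.csSup_mem ⟨r, hrZ⟩ hZlfin
  have hwZ : sInf Zr ∈ Zr := Set.Nonempty.csInf_mem ⟨p, hpZ⟩ hZrfin
  have hru : r ≤ sSup Zl := le_csSup hZlfin.bddAbove hrZ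
  have hwp : sInf Zr ≤ p := csInf_le hZrfin.bddBelow hpZ
  have hne : ∀ x ∈ Ioo (sSup Zl) (sInf Zr), (arcPhi f j a δ x).im ≠ 0 := by
    intro x hx h0
    have hxI : x ∈ Icc (0 : ℝ) (1 / 2) := ⟨by linarith [huZ.1.1.1, hx.1], by linarith [hwZ.1.1.2, hx.2]⟩
    rcases lt_trichotomy x t with hlt | heq | hgt
    · have := le_csSup hZlfin.bddAbove (⟨⟨hxI, h0⟩, hlt⟩ : x ∈ Zl)
      linarith [hx.1]
    · rw [heq] at h0
      linarith
    · have := csInf_le hZrfin.bddBelow (⟨⟨hxI, h0⟩, hgt⟩ : x ∈ Zr)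
      linarith [hx.2]
  have hsign := pos_or_neg_of_ne_zero (hcont.mono (Icc_subset_Icc huZ.1.1.1 hwZ.1.1.2)) hne
  have hpos : ∀ x ∈ Ioo (sSup Zl) (sInf Zr), 0 < (arcPhi f j a δ x).im := by
    rcases hsign with h | h
    · exact h
    · have := h t ⟨huZ.2, hwZ.2⟩
      linarith
  exact ⟨sSup Zl, sInf Zr, ⟨huZ.1.1.1, by linarith [huZ.2, hwZ.2], hwZ.1.1.2, hpos, huZ.1.2, hwZ.1.2⟩, hru, huZ.2, hwZ.2, hwp⟩

/-- ★★ FIRST-DROP LEMMA.  Finitely many real points, `Im φ` continuous, `φ ≠ 0` at its real points, GAP ORDER.  Then strictly between two ASCENDING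
pieces there is a DESCENDING one. -/
theorem exists_desc_between (hfin : {t : ℝ | t ∈ Icc (0 : ℝ) (1 / 2) ∧ (arcPhi f j a δ t).im = 0}.Finite)
    (hcont : ContinuousOn (fun t => (arcPhi f j a δ t).im) (Icc 0 (1 / 2)))
    (hre : ∀ t ∈ Icc (0 : ℝ) (1 / 2), (arcPhi f j a δ t).im = 0 → (arcPhi f j a δ t).re ≠ 0) (hO : ArcGapOrder f j a δ)
    {s s' : ℝ} (hs : s ∈ ascStarts f j a δ) (hs' : s' ∈ ascStarts f j a δ) (hss' : s < s') :
    ∃ d ∈ descStarts f j a δ, s < d ∧ d < s' := by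
  classical
  obtain ⟨e, hP, hlo, hhi⟩ := hs
  obtain ⟨e', hP', hlo', -⟩ := hs'
  have hes' : e ≤ s' := badPiece_le_of_lt hP hP' hss'
  -- the EARLIEST piece start in `[e, s']` with negative `Re φ`
  set S : Set ℝ := {p | (∃ q, BadPiece f j a δ p q) ∧ e ≤ p ∧ p ≤ s' ∧ (arcPhi f j a δ p).re < 0} with hSdef
  have hSfin : S.Finite := hfin.subset (by
    rintro p ⟨⟨q, hpq⟩, -, -, -⟩
    exact ⟨⟨hpq.1, by linarith [hpq.2.1, hpq.2.2.1]⟩, hpq.2.2.2.2.1⟩)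
  have hs'S : s' ∈ S := ⟨⟨e', hP'⟩, hes', le_rfl, hlo'⟩
  have hp₀S : sInf S ∈ S := Set.Nonempty.csInf_mem ⟨s', hs'S⟩ hSfin
  have hp₀min : ∀ p ∈ S, sInf S ≤ p := fun p hp => csInf_le hSfin.bddBelow hp
  set p₀ : ℝ := sInf S with hp₀
  obtain ⟨⟨q₀, hP₀⟩, hep₀, hp₀s', hlo₀⟩ := hp₀S
  -- the LATEST piece start in `[s, p₀)`
  set Q : Set ℝ := {p | (∃ q, BadPiece f j a δ p q) ∧ s ≤ p ∧ p < p₀} with hQdef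
  have hQfin : Q.Finite := hfin.subset (by
    rintro p ⟨⟨q, hpq⟩, -, -⟩
    exact ⟨⟨hpq.1, by linarith [hpq.2.1, hpq.2.2.1]⟩, hpq.2.2.2.2.1⟩)
  have hsp₀ : s < p₀ := lt_of_lt_of_le hP.2.1 hep₀
  have hsQ : s ∈ Q := ⟨⟨e, hP⟩, le_rfl, hsp₀⟩
  have hq₁Q : sSup Q ∈ Q := Set.Nonempty.csSup_mem ⟨s, hsQ⟩ hQfin
  have hq₁max : ∀ p ∈ Q, p ≤ sSup Q := fun p hp => le_csSup hQfin.bddAbove hp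
  set q₁ : ℝ := sSup Q with hq₁
  obtain ⟨⟨r, hPq⟩, hsq₁, hq₁p₀⟩ := hq₁Q
  have hrp₀ : r ≤ p₀ := badPiece_le_of_lt hPq hP₀ hq₁p₀
  -- no bad point between `r` and `p₀` (else a piece would start inside `(q₁, p₀)`)
  have hgap : ∀ t ∈ Icc r p₀, (arcPhi f j a δ t).im ≤ 0 := by
    intro t ht
    by_contra hpos
    push Not at hpos
    have hrt : r < t := lt_of_le_of_ne ht.1 (by rintro rfl; linarith [hPq.2.2.2.2.2])
    have htp : t < p₀ := lt_of_le_of_ne ht.2 (by rintro rfl; linarith [hP₀.2.2.2.2.1])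
    obtain ⟨u, w, hPuw, hru, hut, -, -⟩ := exists_badPiece_around hfin hcont (by linarith [hPq.1, hPq.2.1]) hPq.2.2.2.2.2
      (by linarith [hP₀.2.1, hP₀.2.2.1]) hP₀.2.2.2.2.1 hrt htp hpos
    have huQ : u ∈ Q := ⟨⟨w, hPuw⟩, by linarith [hPq.2.1], by linarith⟩
    have := hq₁max u huQ
    linarith [hPq.2.1]
  -- gap order between `(q₁, r)` and `(p₀, q₀)`
  have hord := hO q₁ r p₀ q₀ hPq hP₀ hrp₀ hgap
  -- `q₁ ≠ s` (the piece `(s, e)` ends with positive `Re φ`)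
  have hsq₁' : s < q₁ := by
    rcases eq_or_lt_of_le hsq₁ with heq | hlt
    · exfalso
      have hPs : BadPiece f j a δ s r := by rw [heq]; exact hPq
      have : r = e := badPiece_end_unique hPs hP
      rw [this] at hord
      linarith
    · exact hlt
  have heq₁ : e ≤ q₁ := badPiece_le_of_lt hP hPq hsq₁'
  -- `Re φ(q₁) > 0`: otherwise `q₁ ∈ S`, contradicting the minimality of `p₀`
  have hloq : 0 < (arcPhi f j a δ q₁).re := by
    rcases lt_trichotomy (arcPhi f j a δ q₁).re 0 with hneg | hzero | hpos
    · have hmem : q₁ ∈ S := ⟨⟨r, hPq⟩, heq₁, by linarith, hneg⟩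
      linarith [hp₀min q₁ hmem]
    · exact absurd hzero (hre q₁ ⟨hPq.1, by linarith [hPq.2.1, hPq.2.2.1]⟩ hPq.2.2.2.2.1)
    · exact hpos
  exact ⟨q₁, ⟨r, hPq, hloq, by linarith⟩, hsq₁', by linarith⟩

/-- ★★ THE COUNT.  Finitely many real points, `Im φ` continuous, `φ ≠ 0` at its real points, GAP ORDER ⇒ `#asc ≤ #desc + 1` (the map «`s ↦` first
descending start after `s`» is injective on the ascending starts other than the last). -/
theorem netCount_of_gapOrder (hfin : {t : ℝ | t ∈ Icc (0 : ℝ) (1 / 2) ∧ (arcPhi f j a δ t).im = 0}.Finite)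
    (hcont : ContinuousOn (fun t => (arcPhi f j a δ t).im) (Icc 0 (1 / 2)))
    (hre : ∀ t ∈ Icc (0 : ℝ) (1 / 2), (arcPhi f j a δ t).im = 0 → (arcPhi f j a δ t).re ≠ 0) (hO : ArcGapOrder f j a δ) :
    (ascStarts f j a δ).Finite ∧ (ascStarts f j a δ).ncard ≤ (descStarts f j a δ).ncard + 1 := by
  classical
  have hAfin : (ascStarts f j a δ).Finite := hfin.subset (ascSet_subset (arcPhi f j a δ))
  have hDfin : (descStarts f j a δ).Finite := hfin.subset (descSet_subset (arcPhi f j a δ))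
  refine ⟨hAfin, ?_⟩
  by_cases hA0 : ascStarts f j a δ = ∅
  · rw [hA0, Set.ncard_empty]; exact Nat.zero_le _
  have hAne : (ascStarts f j a δ).Nonempty := Set.nonempty_iff_ne_empty.2 hA0
  have hsM : sSup (ascStarts f j a δ) ∈ ascStarts f j a δ := hAne.csSup_mem hAfin
  have hle : ∀ s ∈ ascStarts f j a δ, s ≤ sSup (ascStarts f j a δ) := fun s hs => le_csSup hAfin.bddAbove hs
  set sM : ℝ := sSup (ascStarts f j a δ) with hsMdef
  set g : ℝ → ℝ := fun s => sInf {d : ℝ | d ∈ descStarts f j a δ ∧ s < d} with hg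
  have hgspec : ∀ s ∈ ascStarts f j a δ \ {sM}, g s ∈ descStarts f j a δ ∧ s < g s ∧ ∀ d ∈ descStarts f j a δ, s < d → g s ≤ d := by
    intro s hs
    rw [Set.mem_sdiff_singleton] at hs
    have hslt : s < sM := lt_of_le_of_ne (hle s hs.1) hs.2
    obtain ⟨d, hd, hsd, -⟩ := exists_desc_between hfin hcont hre hO hs.1 hsM hslt
    have hTne : ({d : ℝ | d ∈ descStarts f j a δ ∧ s < d}).Nonempty := ⟨d, hd, hsd⟩
    have hTfin : ({d : ℝ | d ∈ descStarts f j a δ ∧ s < d}).Finite := hDfin.subset fun x hx => hx.1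
    have hmem := hTne.csInf_mem hTfin
    exact ⟨hmem.1, hmem.2, fun d' hd' hsd' => csInf_le hTfin.bddBelow ⟨hd', hsd'⟩⟩
  have hinj : Set.InjOn g (ascStarts f j a δ \ {sM}) := by
    intro s₁ hs₁ s₂ hs₂ heq
    by_contra hne
    have hs₁A : s₁ ∈ ascStarts f j a δ := (Set.mem_sdiff_singleton.1 hs₁).1
    have hs₂A : s₂ ∈ ascStarts f j a δ := (Set.mem_sdiff_singleton.1 hs₂).1
    rcases lt_or_gt_of_ne hne with hlt | hlt
    · obtain ⟨d, hd, h1d, hd2⟩ := exists_desc_between hfin hcont hre hO hs₁A hs₂A hlt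
      have h1 := (hgspec s₁ hs₁).2.2 d hd h1d
      have h2 := (hgspec s₂ hs₂).2.1
      rw [heq] at h1
      linarith
    · obtain ⟨d, hd, h2d, hd1⟩ := exists_desc_between hfin hcont hre hO hs₂A hs₁A hlt
      have h1 := (hgspec s₂ hs₂).2.2 d hd h2d
      have h2 := (hgspec s₁ hs₁).2.1
      rw [← heq] at h1
      linarith
  have hcard := Set.ncard_le_ncard_of_injOn g (fun s hs => (hgspec s hs).1) hinj hDfin
  have hadd := Set.ncard_sdiff_singleton_add_one hsM hAfin
  omega

end Pieces

/-! ## §3 The generic radius, and the law-level reduction -/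

set_option maxHeartbeats 800000 in
/-- ★ GAP ORDER on the small circles (cofinitely) ⇒ `NetLeOne` — the finitely many radii through a zero of `f^{(j)}` or `f^{(j+1)}` are thrown out;
elsewhere part Dʼs `breaks_finite_or_flat` and §2 apply. -/
theorem netLeOne_of_gapOrder {η : ℝ} {f : ℂ → ℂ} {x₀ s hmax R Hs : ℝ} {B : ℕ} (hE : EngineHyps5 2 η f x₀ s hmax R Hs B) {j : ℕ} {a : ℂ}
    (ha : iteratedDeriv j f a = 0) (hapos : 0 < a.im) (hnz : iteratedDeriv j f ≠ 0)
    (hO : ∃ d0 > 0, ∃ E : Set ℝ, E.Finite ∧ ∀ δ ∈ Ioo 0 d0 \ E, ArcGapOrder f j a δ) : NetLeOne f j a := by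
  classical
  have hf : RealEntireLt2 f := realEntireLt2_of_hyps hE
  set G : ℂ → ℂ := iteratedDeriv j f with hGdef
  have hG : RealEntireLt2 G := RhW08.WindowLoss.realEntireLt2_iteratedDeriv hf j
  have e1 : deriv G = iteratedDeriv (j + 1) f := by rw [hGdef, ← iteratedDeriv_succ]
  have hHs : 0 ≤ Hs := hE.2.2.2.2.2.2.2.1
  have hG'ne : iteratedDeriv (j + 1) f ≠ 0 := iteratedDeriv_succ_ne_zero_of_zero hf.diff j hnz ha
  have hG'd : Differentiable ℂ (iteratedDeriv (j + 1) f) := differentiable_iteratedDeriv_of_entire hf.diff (j + 1)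
  obtain ⟨d0, hd0, E, hEfin, hO⟩ := hO
  set L : ℝ := a.im + Hs + 2 with hL
  have hz₀ : ((a.re : ℂ)) ∈ Ioo (a.re - L) (a.re + L) ×ℂ Ioo (-(Hs + 1)) (Hs + 1) :=
    ofReal_mem_box (by rw [sub_self, abs_zero]; linarith) hHs
  set Z : Set ℂ := {ρ : ℂ | G ρ = 0 ∧ ρ ∈ Ioo (a.re - L) (a.re + L) ×ℂ Ioo (-(Hs + 1)) (Hs + 1)} ∪
    {ρ : ℂ | iteratedDeriv (j + 1) f ρ = 0 ∧ ρ ∈ Ioo (a.re - L) (a.re + L) ×ℂ Ioo (-(Hs + 1)) (Hs + 1)} with hZ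
  have hZfin : Z.Finite := (finite_zeros_box hG.diff hnz hz₀).union (finite_zeros_box hG'd hG'ne hz₀)
  have hbad : ((fun ρ : ℂ => ‖ρ - (a.re : ℂ)‖ - a.im) '' Z ∪ E).Finite := (hZfin.image _).union hEfin
  refine ⟨min d0 1, lt_min hd0 one_pos, _, hbad, fun δ hδ => ?_⟩
  obtain ⟨⟨hδ0, hδ1⟩, hδbad⟩ := hδ
  have hδd0 : δ < d0 := lt_of_lt_of_le hδ1 (min_le_left _ _)
  have hδone : δ < 1 := lt_of_lt_of_le hδ1 (min_le_right _ _)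
  have hr : 0 < a.im + δ := by linarith
  have haHs : |a.im| ≤ Hs := abs_im_le_of_level hE hnz ha
  rw [abs_of_pos hapos] at haHs
  have hbox : ∀ u : ℂ, ‖u - (a.re : ℂ)‖ = a.im + δ → u ∈ Ioo (a.re - L) (a.re + L) ×ℂ Ioo (-(Hs + 1)) (Hs + 1) := by
    intro u hu
    have h1 := abs_re_le_norm (u - (a.re : ℂ))
    have h2 := abs_im_le_norm (u - (a.re : ℂ))
    rw [hu] at h1 h2
    rw [sub_re, ofReal_re, abs_le] at h1
    rw [sub_im, ofReal_im, sub_zero, abs_le] at h2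
    exact mem_reProdIm.2 ⟨⟨by linarith [h1.1], by linarith [h1.2]⟩, ⟨by linarith [h2.1], by linarith [h2.2]⟩⟩
  have hG0 : ∀ u : ℂ, ‖u - ((a.re : ℝ) : ℂ)‖ = a.im + δ → G u ≠ 0 := fun u hu h0 =>
    hδbad (Or.inl ⟨u, Or.inl ⟨h0, hbox u hu⟩, by simp only [hu]; ring⟩)
  have hG'0 : ∀ u : ℂ, ‖u - ((a.re : ℝ) : ℂ)‖ = a.im + δ → iteratedDeriv (j + 1) f u ≠ 0 := fun u hu h0 =>
    hδbad (Or.inl ⟨u, Or.inr ⟨h0, hbox u hu⟩, by simp only [hu]; ring⟩)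
  have hδE : δ ∉ E := fun h => hδbad (Or.inr h)
  have hγ : ∀ t : ℝ, ‖circleLoop (a.re : ℂ) (a.im + δ) t - (a.re : ℂ)‖ = a.im + δ := fun t => by
    rw [norm_circleLoop_sub_center, abs_of_pos hr]
  have hG0t : ∀ t : ℝ, G (circleLoop (a.re : ℂ) (a.im + δ) t) ≠ 0 := fun t => hG0 _ (hγ t)
  have hcont : ContinuousOn (fun t => (arcPhi f j a δ t).im) (Icc 0 (1 / 2)) := fun t _ =>
    (analyticAt_im_logDeriv_circleLoop hG.diff hG0t t).continuousAt.continuousWithinAt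
  have hre : ∀ t ∈ Icc (0 : ℝ) (1 / 2), (arcPhi f j a δ t).im = 0 → (arcPhi f j a δ t).re ≠ 0 := by
    intro t _ him hre0
    have hφ0 : arcPhi f j a δ t = 0 := Complex.ext (by rw [hre0]; rfl) (by rw [him]; rfl)
    have hd : deriv G (circleLoop (a.re : ℂ) (a.im + δ) t) = 0 := by
      rcases div_eq_zero_iff.1 hφ0 with h1 | h2
      · exact h1
      · exact absurd h2 (hG0t t)
    rw [e1] at hd
    exact hG'0 _ (hγ t) hd
  rcases breaks_finite_or_flat hG.diff hG0t with hfin | hflat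
  · exact netCount_of_gapOrder hfin hcont hre (hO δ ⟨⟨hδ0, hδd0⟩, hδE⟩)
  · have hA : ascStarts f j a δ = ∅ := by
      rw [ascStarts_eq_ascSet]
      exact ascSet_eq_empty_of_flat (Γ := arcPhi f j a δ) hflat
    rw [hA]
    exact ⟨Set.finite_empty, by rw [Set.ncard_empty]; exact Nat.zero_le _⟩

/-- ★★ THE REDUCTION: the atomic GAP-ORDER law gives the atomic NET law. -/
theorem atomicNetLaw_of_gapOrderLaw (h : AtomicGapOrderLawQ) : AtomicNetLawQ := by
  intro η f x₀ s hmax R Hs B hE j a v ha hapos hN hA hda hdv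
  have hf : RealEntireLt2 f := realEntireLt2_of_hyps hE
  have hnz : iteratedDeriv j f ≠ 0 := by
    intro h0
    apply hdv
    rw [iteratedDeriv_succ, h0]; simp
  exact netLeOne_of_gapOrder hE ha hapos hnz (h η f x₀ s hmax R Hs B hE j a v ha hapos hN hA hda hdv)

/-- … hence GAP ORDER + the non-atomic residual give part Iʼs residual (via part Jʼs NET split) … -/
theorem topPinningResidual_of_gapOrderSplit (hO : AtomicGapOrderLawQ) (hR : NonAtomicTopResidualQ) : TopPinningNonNestedAscResidual :=
  topPinningResidual_of_netSplit (atomicNetLaw_of_gapOrderLaw hO) hR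

/-- … and `TopPinning`. -/
theorem topPinning_of_gapOrderSplit (hO : AtomicGapOrderLawQ) (hR : NonAtomicTopResidualQ) : TopPinning :=
  topPinning_of_nonNestedAscResidual (topPinningResidual_of_gapOrderSplit hO hR)

end RhW08.Lens1ArcSign

-- ======== TongueSeal-v1 (part M; import lines stripped) ========

/-!
# TiltedLandingLaw421R3 — lens-1 (part M): the TONGUE SEAL typed; Cauchy–Riemann monotonicity along a nodal arc PROVED; SEAL ⇒ GAP ORDER

LENS-1 gen-7 module image `rh33346-cover/lens-1/TongueSeal-v1.lean` (landing target `…/Theorems/TiltedLandingLaw421R3Lens1ArcSignM.lean`; ONE import = part L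
`…R3Lens1ArcSignL` = image `lens-1/AtomicGapOrder-v1.lean` ded7221aba373285 until it is tree; namespace `RhW08.Lens1ArcSign`; 0 `sorry`; checked BY CHAIN
`lens-1/TongueSeal-v1-chain.lean` over the tree parts A–I + `…R3NestedSign`).  Director (CA689)(D) = SUMMON duty (O7-5).

WHY THIS FILE.  The one un-typed input of the atomic branch is C6ʼs TONGUE PROPOSITION (g37 §2.6): between two consecutive bad pieces of a small circle
`C = ∂D`, `D = ball (Re a) (Im a + δ)`, let `R` be the component of `{Im φ < 0} ∩ D` along the gap; IF (i) `closure R` meets `C` only along the gap and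
(ii) no real zero of `f^{(j)}` lies on `∂R`, THEN walking `∂R ∖ gap` from `w₂ = γ(t₃)` (start of the later piece) back to `w₁ = γ(t₂)` (end of the earlier
one) with `R` on the left, `Re φ` never increases (Cauchy–Riemann: the tangential derivative of `Re φ` is the normal derivative of `Im φ` INTO `R`, which is
`≤ 0` on a nodal line bounding `{Im φ < 0}`), so `hi = Re φ(w₁) ≤ Re φ(w₂) = lo` — GAP ORDER.  Mathlib has no nodal-set / connected-component machinery to
speak of `R`, so the proposition is typed here in PATH CURRENCY, which is exactly what the boundary walk produces and what an instrument traces: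
★ `SealingPath f j a δ t₂ t₃` := a differentiable arc `σ : [0,1] → closedBall`, `σ 0 = γ t₃`, `σ 1 = γ t₂`, along which `f^{(j)} ≠ 0` ((ii)),
`Im φ = 0` (nodal) and `Im φ ≤ 0` immediately to the LEFT (direction `i·σ′`; the tongue side); (i) is the statement that the walk from `w₂` ARRIVES at `w₁` (it exists
as a path in the closed disc ending there).  ★ `TongueSealQ` := on a legal frame, for a simple top zero with a simple atomic mate, outside finitely many radii
every CONSECUTIVE gap (no bad point between the pieces) has a sealing path; `TongueSealAllQ` := the same for all ordered pairs of pieces (what would give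
part Kʼs all-pairs `ArcOrder`; recorded because the census verified all pairs, not claimed by the mechanism).

CONTENT. §1 (pure calculus, no frame) `deriv_nonpos_of_right_nonpos` (a function vanishing at `0`, `≤ 0` on `(0, ε₀)`, differentiable at `0`, has derivative
`≤ 0`) and ★★ `re_antitoneOn_of_nodal_left` — CR-MONOTONICITY ALONG A NODAL ARC, PROVED: `φ` complex-differentiable at the points of a differentiable arc `σ`
on `[s₀,s₁]`, `Im φ ∘ σ = 0`, `Im φ ≤ 0` just left of `σ` ⇒ `Re φ ∘ σ` is antitone (`d/ds Re φ(σ) = Re(φ′σ′) = d/dε Im φ(σ + ε iσ′)|₀ ≤ 0`,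
then the mean value theorem) · §2 `SealingPath`, `TongueSealQ`, `TongueSealAllQ` (OPEN, typed) · §3 ★★ `re_le_of_sealingPath` (a sealing path orders the two piece ends), ★★
`atomicGapOrderLaw_of_tongueSeal : TongueSealQ → AtomicGapOrderLawQ`, `atomicOrderLaw_of_tongueSealAll : TongueSealAllQ → AtomicOrderLawQ` (the directorʼs
`atomicOrderLaw_of_tongueSeal`, at the strength the all-pairs law needs), and the corollaries down the ladder of parts J/K/L:
`TongueSealQ ⟹ AtomicGapOrderLawQ ⟹ AtomicNetLawQ ⟹ (RUNG 4) the law on the atomic class`; with `NonAtomicTopResidualQ`, `TopPinning`.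

WHY IT MIGHT FAIL (the typed seal, not the reduction).  (ii) A TOOTH ON THE TONGUE BOUNDARY: if `R` reaches the real chord of `D` at a real zero `x₀` of
`f^{(j)}`, the boundary walk passes a pole of `φ`; walked with `R` on the left the chord is traversed eastward and `Re φ ≈ m/(x − x₀)` jumps UPWARD there — no
sealing path with `f^{(j)} ≠ 0` exists and the monotonicity genuinely breaks at that point (gap order may still hold by compensation; census 0/247 360 with
teeth, g37).  (i) THE TONGUE REACHES A SECOND ARC of `C` (or escapes through the lower half of `D`): the walk from `w₂` ends on `C ∖ {w₁}` and orders the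
wrong pair of values.  Both are exactly C6ʼs residue (i)/(ii); the (O7-4) falsifier (atomic rows with 0–3 teeth, all pairs) probes them.  `TongueSealQ` is
STRONGER than `AtomicGapOrderLawQ` (it may fail where gap order survives); the law of record for payment stays `AtomicGapOrderLawQ` (part L).

HONEST LABEL: one calculus lemma + typing + reductions; `TongueSealQ`, every atomic law, `TopPinning`, 33346, 33347 OPEN; nothing here bears on the truth
of RH; RH is not proved; checked ≠ landed ≠ proved.
-/

noncomputable section

namespace RhW08.Lens1ArcSign

open Complex Set Metric Filter Topology
open scoped Real ComplexConjugate
open Literature.Topology.PlaneTopology Literature.Analysis.Complex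
open Summit.RiemannHypothesis.RiemannHypothesis.Theorems.Splittings.JensenWindow
open RhIdea6.G17.W07C7 RhIdea6.G17.W07C7.Rev6 RhIdea6.G18.W07C8.Law421BirthS RhIdea6.G19.W07C11.Seam
open RhIdea6.G20.W07C12.Frac RhIdea6.G20.W07C12.StColP RhW07.C12.FieldSplit RhIdea6.G21.W07C13.TentMax
open RhW07.C14.TwoSided RhW07.C14.Classes RhW07.C14.Lineage RhW07.C14.Booking
open RhW07.C13.Heredity RhIdea6.G22.W07C15pre.Injection RhW07.E3.Cell RhW07.E3.Lit
open RhW08.Round1 RhW08.StSwap RhW08.Round2 RhW08.QuadW RhW08.SealSwapQ RhW08.SealSwap RhW08.SuccB RhW08.SuccSplit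
open RhW08.SuccTheft RhW08.Column RhW08.Hurwitz RhW08.ClusterQ RhW08.ClusterQM RhW08.NewtonDoor RhW08.NewtonDoorGenusOne RhW08.PurseP
open RhW08.Lens1SignCut RhW08.Lens1Coverage RhW08.IsolatedTilt RhW08.Lens1Pinning RhW08.Lens1PinningIso

/-! ## §1 Cauchy–Riemann monotonicity along a nodal arc (pure calculus) -/

/-- A real function vanishing at `0`, non-positive on `(0, ε₀)` and differentiable at `0` has derivative `≤ 0` there. -/
theorem deriv_nonpos_of_right_nonpos {g : ℝ → ℝ} {g' ε₀ : ℝ} (hg : HasDerivAt g g' 0) (h0 : g 0 = 0) (hε₀ : 0 < ε₀)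
    (hle : ∀ ε ∈ Ioo 0 ε₀, g ε ≤ 0) : g' ≤ 0 := by
  refine le_of_tendsto hg.tendsto_slope_zero_right ?_
  filter_upwards [Ioo_mem_nhdsGT hε₀] with ε hε
  rw [zero_add, h0, sub_zero, smul_eq_mul]
  exact mul_nonpos_of_nonneg_of_nonpos (inv_nonneg.2 hε.1.le) (hle ε hε)

/-- `Im (φ′ · iσ′) = Re (φ′ σ′)`: the normal derivative of `Im φ` to the left of an arc is the tangential derivative of `Re φ` (Cauchy–Riemann). -/
theorem im_mul_I_mul (z w : ℂ) : (z * (I * w)).im = (z * w).re := by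
  simp only [Complex.mul_im, Complex.mul_re, Complex.I_re, Complex.I_im]; ring

/-- ★★ CR-MONOTONICITY ALONG A NODAL ARC.  Let `σ` be differentiable on `[s₀, s₁]` with derivative `σ′`, `φ` complex-differentiable at every `σ s`,
`Im φ (σ s) = 0` (a nodal arc of `Im φ`) and `Im φ ≤ 0` immediately to the LEFT of `σ` (at `σ s + ε·iσ′(s)`, small `ε > 0`).  Then `Re φ ∘ σ` is
non-increasing on `[s₀, s₁]`.  (Where `σ′ = 0` — corners of a piecewise-analytic nodal line, slowed down — both conditions are empty and the derivative of
`Re φ ∘ σ` vanishes; monotonicity is unaffected.) -/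
theorem re_antitoneOn_of_nodal_left {φ : ℂ → ℂ} {σ σ' : ℝ → ℂ} {s₀ s₁ : ℝ}
    (hφ : ∀ s ∈ Icc s₀ s₁, DifferentiableAt ℂ φ (σ s)) (hσ : ∀ s ∈ Icc s₀ s₁, HasDerivAt σ (σ' s) s)
    (hnodal : ∀ s ∈ Icc s₀ s₁, (φ (σ s)).im = 0)
    (hleft : ∀ s ∈ Icc s₀ s₁, ∃ ε₀ : ℝ, 0 < ε₀ ∧ ∀ ε ∈ Ioo (0 : ℝ) ε₀, (φ (σ s + (ε : ℂ) * (I * σ' s))).im ≤ 0) :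
    AntitoneOn (fun s => (φ (σ s)).re) (Icc s₀ s₁) := by
  -- the derivative of `Re φ ∘ σ`
  have hF : ∀ s ∈ Icc s₀ s₁, HasDerivAt (fun s => (φ (σ s)).re) ((deriv φ (σ s) * σ' s).re) s := by
    intro s hs
    have h1 : HasDerivAt (fun s => φ (σ s)) (deriv φ (σ s) * σ' s) s := (hφ s hs).hasDerivAt.comp s (hσ s hs)
    simpa only [Function.comp_def, Complex.reCLM_apply] using Complex.reCLM.hasFDerivAt.comp_hasDerivAt s h1
  -- its sign, from the one-sided condition
  have hsgn : ∀ s ∈ Icc s₀ s₁, (deriv φ (σ s) * σ' s).re ≤ 0 := by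
    intro s hs
    obtain ⟨ε₀, hε₀, hle⟩ := hleft s hs
    have hpath : HasDerivAt (fun ε : ℝ => σ s + (ε : ℂ) * (I * σ' s)) (I * σ' s) 0 := by
      simpa using ((Complex.ofRealCLM.hasDerivAt (x := (0 : ℝ))).mul_const (I * σ' s)).const_add (σ s)
    have hφ0 : HasDerivAt φ (deriv φ (σ s)) (σ s + ((0 : ℝ) : ℂ) * (I * σ' s)) := by
      simpa using (hφ s hs).hasDerivAt
    have hg : HasDerivAt (fun ε : ℝ => (φ (σ s + (ε : ℂ) * (I * σ' s))).im) ((deriv φ (σ s) * (I * σ' s)).im) 0 := by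
      simpa [Function.comp_def] using Complex.imCLM.hasFDerivAt.comp_hasDerivAt (0 : ℝ) (hφ0.comp (0 : ℝ) hpath)
    have key := deriv_nonpos_of_right_nonpos hg (by simpa using hnodal s hs) hε₀ hle
    rwa [im_mul_I_mul] at key
  refine antitoneOn_of_deriv_nonpos (convex_Icc s₀ s₁) (fun s hs => (hF s hs).continuousAt.continuousWithinAt)
    (fun s hs => (hF s (interior_subset hs)).differentiableAt.differentiableWithinAt) ?_
  intro s hs
  rw [(hF s (interior_subset hs)).deriv]
  exact hsgn s (interior_subset hs)

/-! ## §2 The tongue seal, typed in path currency -/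

/-- ★ A SEALING PATH for the gap between a piece ending at `t₂` and a piece starting at `t₃` (radius excess `δ`): a differentiable arc in the CLOSED disc
from `γ(t₃)` back to `γ(t₂)` along which `f^{(j)} ≠ 0` (C6ʼs (ii): no tooth on the tongue boundary), `Im φ = 0` (it runs in the nodal set) and `Im φ ≤ 0`
immediately to its LEFT (the negative tongue `R` is on the left of the walk `w₂ → w₁`; C6ʼs (i) = the walk arrives at `w₁`).  `φ = (f^{(j)})′/f^{(j)}`,
`γ = circleLoop (Re a) (Im a + δ)`. -/
def SealingPath (f : ℂ → ℂ) (j : ℕ) (a : ℂ) (δ t₂ t₃ : ℝ) : Prop :=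
  ∃ σ σ' : ℝ → ℂ, σ 0 = circleLoop (a.re : ℂ) (a.im + δ) t₃ ∧ σ 1 = circleLoop (a.re : ℂ) (a.im + δ) t₂ ∧
    ∀ s ∈ Icc (0 : ℝ) 1, HasDerivAt σ (σ' s) s ∧ σ s ∈ closedBall (a.re : ℂ) (a.im + δ) ∧ iteratedDeriv j f (σ s) ≠ 0 ∧
      (deriv (iteratedDeriv j f) (σ s) / iteratedDeriv j f (σ s)).im = 0 ∧
      ∃ ε₀ : ℝ, 0 < ε₀ ∧ ∀ ε ∈ Ioo (0 : ℝ) ε₀,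
        (deriv (iteratedDeriv j f) (σ s + (ε : ℂ) * (I * σ' s)) / iteratedDeriv j f (σ s + (ε : ℂ) * (I * σ' s))).im ≤ 0

/-- ★ THE TONGUE SEAL (OPEN; C6 g37 §2.6 Proposition typed; SUMMON (O7-5)).  On a legal frame, for a simple top zero `a` with a simple ATOMIC mate `v`:
outside finitely many radii, every pair of CONSECUTIVE bad pieces of the small circle (`Im φ ≤ 0` on the closed gap between them) is joined by a sealing
path.  WHY IT MIGHT FAIL: a tooth on the tongue boundary (the walk meets a pole of `φ` on the real chord; `Re φ` jumps upward there); the tongue reaching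
a second arc of the circle (the walk from `w₂` does not return to `w₁`).  Census behind it: ORDER 0/5 845 violations incl. 0/247 360 tooth insertions (C6
g37), residue (i)/(ii) 174/174 + 75/75 (g38); unproved.  STRONGER than `AtomicGapOrderLawQ`. -/
def TongueSealQ : Prop :=
  ∀ (η : ℝ) (f : ℂ → ℂ) (x₀ s hmax R Hs : ℝ) (B : ℕ), EngineHyps5 2 η f x₀ s hmax R Hs B → ∀ (j : ℕ) (a v : ℂ),
    iteratedDeriv j f a = 0 → 0 < a.im → NoTallerToucher f j a → Atomic f j a v →
    iteratedDeriv (j + 1) f a ≠ 0 → iteratedDeriv (j + 1) f v ≠ 0 → ∃ d0 > 0, ∃ E : Set ℝ, E.Finite ∧ ∀ δ ∈ Ioo 0 d0 \ E,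
      ∀ t₁ t₂ t₃ t₄ : ℝ, BadPiece f j a δ t₁ t₂ → BadPiece f j a δ t₃ t₄ → t₂ ≤ t₃ →
        (∀ t ∈ Icc t₂ t₃, (arcPhi f j a δ t).im ≤ 0) → SealingPath f j a δ t₂ t₃

/-- The ALL-PAIRS tongue seal (OPEN; what part Kʼs all-pairs `ArcOrder` would need; the census verified all pairs, the mechanism speaks to consecutive
gaps only — recorded, not advocated). -/
def TongueSealAllQ : Prop :=
  ∀ (η : ℝ) (f : ℂ → ℂ) (x₀ s hmax R Hs : ℝ) (B : ℕ), EngineHyps5 2 η f x₀ s hmax R Hs B → ∀ (j : ℕ) (a v : ℂ),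
    iteratedDeriv j f a = 0 → 0 < a.im → NoTallerToucher f j a → Atomic f j a v →
    iteratedDeriv (j + 1) f a ≠ 0 → iteratedDeriv (j + 1) f v ≠ 0 → ∃ d0 > 0, ∃ E : Set ℝ, E.Finite ∧ ∀ δ ∈ Ioo 0 d0 \ E,
      ∀ t₁ t₂ t₃ t₄ : ℝ, BadPiece f j a δ t₁ t₂ → BadPiece f j a δ t₃ t₄ → t₂ ≤ t₃ → SealingPath f j a δ t₂ t₃

/-- All-pairs seal ⇒ consecutive seal. -/
theorem tongueSeal_of_tongueSealAll (h : TongueSealAllQ) : TongueSealQ := by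
  intro η f x₀ s hmax R Hs B hE j a v ha hapos hN hA hda hdv
  obtain ⟨d0, hd0, E, hEfin, hS⟩ := h η f x₀ s hmax R Hs B hE j a v ha hapos hN hA hda hdv
  exact ⟨d0, hd0, E, hEfin, fun δ hδ t₁ t₂ t₃ t₄ h₁ h₂ h23 _ => hS δ hδ t₁ t₂ t₃ t₄ h₁ h₂ h23⟩

/-! ## §3 Seal ⇒ order -/

/-- ★★ A sealing path orders the two piece ends: `Re φ(γ t₂) ≤ Re φ(γ t₃)` («hi ≤ lo»), by CR-monotonicity along the path. -/
theorem re_le_of_sealingPath {f : ℂ → ℂ} {j : ℕ} {a : ℂ} {δ t₂ t₃ : ℝ} (hGd : Differentiable ℂ (iteratedDeriv j f))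
    (h : SealingPath f j a δ t₂ t₃) : (arcPhi f j a δ t₂).re ≤ (arcPhi f j a δ t₃).re := by
  obtain ⟨σ, σ', h0, h1, hP⟩ := h
  have hanti := re_antitoneOn_of_nodal_left (φ := fun w => deriv (iteratedDeriv j f) w / iteratedDeriv j f w) (σ := σ) (σ' := σ')
    (s₀ := 0) (s₁ := 1) (fun s hs => (hGd.deriv.differentiableAt).div (hGd.differentiableAt) (hP s hs).2.2.1)
    (fun s hs => (hP s hs).1) (fun s hs => (hP s hs).2.2.2.1) (fun s hs => (hP s hs).2.2.2.2)
  have h01 := hanti (left_mem_Icc.2 (zero_le_one' ℝ)) (right_mem_Icc.2 (zero_le_one' ℝ)) zero_le_one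
  simp only at h01
  rw [h0, h1] at h01
  exact h01

/-- ★★ (O7-5) TONGUE SEAL ⇒ GAP ORDER at law level. -/
theorem atomicGapOrderLaw_of_tongueSeal (h : TongueSealQ) : AtomicGapOrderLawQ := by
  intro η f x₀ s hmax R Hs B hE j a v ha hapos hN hA hda hdv
  obtain ⟨d0, hd0, E, hEfin, hS⟩ := h η f x₀ s hmax R Hs B hE j a v ha hapos hN hA hda hdv
  have hGd : Differentiable ℂ (iteratedDeriv j f) := differentiable_iteratedDeriv_of_entire (realEntireLt2_of_hyps hE).diff j
  exact ⟨d0, hd0, E, hEfin, fun δ hδ t₁ t₂ t₃ t₄ h₁ h₂ h23 hgap => re_le_of_sealingPath hGd (hS δ hδ t₁ t₂ t₃ t₄ h₁ h₂ h23 hgap)⟩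

/-- The directorʼs `atomicOrderLaw_of_tongueSeal`, at the strength all-pairs ORDER needs: ALL-PAIRS SEAL ⇒ ORDER. -/
theorem atomicOrderLaw_of_tongueSealAll (h : TongueSealAllQ) : AtomicOrderLawQ := by
  intro η f x₀ s hmax R Hs B hE j a v ha hapos hN hA hda hdv
  obtain ⟨d0, hd0, E, hEfin, hS⟩ := h η f x₀ s hmax R Hs B hE j a v ha hapos hN hA hda hdv
  have hGd : Differentiable ℂ (iteratedDeriv j f) := differentiable_iteratedDeriv_of_entire (realEntireLt2_of_hyps hE).diff j
  exact ⟨d0, hd0, E, hEfin, fun δ hδ t₁ t₂ t₃ t₄ h₁ h₂ h23 => re_le_of_sealingPath hGd (hS δ hδ t₁ t₂ t₃ t₄ h₁ h₂ h23)⟩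

/-- Down the ladder (parts L, J): TONGUE SEAL ⇒ the atomic NET law. -/
theorem atomicNetLaw_of_tongueSeal (h : TongueSealQ) : AtomicNetLawQ :=
  atomicNetLaw_of_gapOrderLaw (atomicGapOrderLaw_of_tongueSeal h)

/-- TONGUE SEAL on atomic tops + the non-atomic residual ⇒ the residual statement of part I … -/
theorem topPinningResidual_of_tongueSealSplit (h : TongueSealQ) (hR : NonAtomicTopResidualQ) : TopPinningNonNestedAscResidual :=
  topPinningResidual_of_gapOrderSplit (atomicGapOrderLaw_of_tongueSeal h) hR

/-- … and `TopPinning`. -/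
theorem topPinning_of_tongueSealSplit (h : TongueSealQ) (hR : NonAtomicTopResidualQ) : TopPinning :=
  topPinning_of_nonNestedAscResidual (topPinningResidual_of_tongueSealSplit h hR)

end RhW08.Lens1ArcSign


-- ======== ToothSplit-v1 (part O; import lines stripped) ========


/-!
# TiltedLandingLaw421R3 — lens-1 (part O): the TOOTH SPLIT of the tongue seal / gap-order law (class level, path-free)

LENS-1 gen-8 module image `rh33346-cover/lens-1/ToothSplit-v1.lean` (landing target `…/Theorems/TiltedLandingLaw421R3Lens1ArcSignO.lean`; ONE import =
part M `…R3Lens1ArcSignM`; a sibling of part N `PoleLink-v1`, not needed by it; checked BY CHAIN `lens-1/ToothSplit-v1-chain.lean` = the J ⊕ K ⊕ L ⊕ M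
chain ⊕ this part over the tree parts A–I + `…R3NestedSign`).

WHY (SUMMON (O8-1)).  Part Mʼs `TongueSealQ` can fail in two named ways: a TOOTH (a real zero of `G = f^{(j)}` on the tongueʼs axis contact, where
`Re φ` jumps upward) and a SECOND ARC.  The director asked for the tooth case to be split off BY NAME as an explicit residual (the W7 pattern), with a
PATH-FREE closed condition.  The honest path-free condition is CLASS-LEVEL: «no real zero of `f^{(j)}` in `a`ʼs closed Jensen interval
`[Re a − Im a, Re a + Im a]`» (`NoRealZero f j a`).  It is path-free and closed, and it is the right set: the tongue of radius excess `δ` lives in the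
closed half-disc of radius `Im a + δ`, whose chord shrinks to the closed Jensen interval as `δ → 0`, and the real zeros of `f^{(j)} ≢ 0` near that
interval are finitely many — so on the `NoRealZero` class every chord of `D_δ`, `δ` small, is tooth-free and part Mʼs two failure modes reduce to ONE
(second arc).  The finer per-gap condition the director sketched («no zero of `f^{(j)}` on the closed tongue region cut off by the chord `w₁w₂`») is NOT
typable path-free: the tongueʼs depth (`≤ 0.0586·Im a` adversarially, `0.024·Im a` in C6ʼs traces) can exceed the sagitta of the circular segment over
its own gap (`≈ 0.012·Im a` for a `17.6°` gap), so no disc- or chord-defined region is known to contain the tongueʼs axis contact; locating that contact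
IS the nodal topology.  Recorded as UNDECIDED·IDEA-NEEDED, not typed.

CONTENT.  §1 `NoRealZero`; the restricted laws ★ `TongueSealNRQ` (part Mʼs seal on the no-tooth class), `AtomicGapOrderLawNRQ` (part Lʼs gap order
on the no-tooth class), ★ `AtomicGapOrderLawToothQ` (the TOOTH RESIDUAL: gap order on the class WITH a real zero in the closed Jensen interval — by
C6 g37 0 / 247 360 tooth insertions broke ORDER, so the residual is conjecturally true by COMPENSATION along the walk, not by sealing) · §2 PROVED
bookkeeping: `tongueSealNR_of_tongueSeal`, `atomicGapOrderLawNR_of_tongueSealNR` (part Mʼs `re_le_of_sealingPath` pointwise), the restrictions of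
part Lʼs law to both classes, ★★ the glued split `atomicGapOrderLaw_of_toothSplit : AtomicGapOrderLawNRQ → AtomicGapOrderLawToothQ →
AtomicGapOrderLawQ` (exact, `by_cases`), and its corollaries down to `TopPinningNonNestedAscResidual` / `TopPinning` (with part Jʼs non-atomic
residual): `topPinningResidual_of_toothSplit`, `topPinning_of_toothSplit`, `topPinningResidual_of_sealNRSplit`.

HONEST LABEL / PRICE: typing + exact case split; no analysis.  After this part the atomic branch of the SEAL ladder reads
`TongueSealNRQ ⟹ AtomicGapOrderLawNRQ`, `+ AtomicGapOrderLawToothQ ⟹ AtomicGapOrderLawQ ⟹ AtomicNetLawQ ⟹ (RUNG 4) law on the atomic class`;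
`TongueSealNRQ` still carries the SECOND-ARC failure mode (global nodal topology; part Mʼs docstring), `AtomicGapOrderLawToothQ` carries the tooth
compensation; both OPEN, UNDECIDED.  Part N (`PoleLink-v1`) gives a tooth-free alternative for all cluster sizes.  `TopPinning`, 33346, 33347 OPEN;
nothing here bears on the truth of RH; RH is not proved; checked ≠ landed ≠ proved.
-/

noncomputable section

namespace RhW08.Lens1ArcSign

open Complex Set Metric Filter Topology
open scoped Real ComplexConjugate
open Literature.Topology.PlaneTopology Literature.Analysis.Complex
open Summit.RiemannHypothesis.RiemannHypothesis.Theorems.Splittings.JensenWindow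
open RhIdea6.G17.W07C7 RhIdea6.G17.W07C7.Rev6 RhIdea6.G18.W07C8.Law421BirthS RhIdea6.G19.W07C11.Seam
open RhIdea6.G20.W07C12.Frac RhIdea6.G20.W07C12.StColP RhW07.C12.FieldSplit RhIdea6.G21.W07C13.TentMax
open RhW07.C14.TwoSided RhW07.C14.Classes RhW07.C14.Lineage RhW07.C14.Booking
open RhW07.C13.Heredity RhIdea6.G22.W07C15pre.Injection RhW07.E3.Cell RhW07.E3.Lit
open RhW08.Round1 RhW08.StSwap RhW08.Round2 RhW08.QuadW RhW08.SealSwapQ RhW08.SealSwap RhW08.SuccB RhW08.SuccSplit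
open RhW08.SuccTheft RhW08.Column RhW08.Hurwitz RhW08.ClusterQ RhW08.ClusterQM RhW08.NewtonDoor RhW08.NewtonDoorGenusOne RhW08.PurseP
open RhW08.Lens1SignCut RhW08.Lens1Coverage RhW08.IsolatedTilt RhW08.Lens1Pinning RhW08.Lens1PinningIso

/-! ## §1 The no-tooth class and the restricted laws (statements) -/

/-- NO TOOTH: `f^{(j)}` has no REAL zero in `a`ʼs CLOSED Jensen interval `|x − Re a| ≤ Im a` (path-free, closed; module docstring). -/
def NoRealZero (f : ℂ → ℂ) (j : ℕ) (a : ℂ) : Prop :=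
  ∀ x : ℝ, |x - a.re| ≤ a.im → iteratedDeriv j f (x : ℂ) ≠ 0

/-- ★ THE TONGUE SEAL ON THE NO-TOOTH CLASS (OPEN): part Mʼs `TongueSealQ` with the extra binder `NoRealZero f j a`.  Remaining failure mode: the
tongue reaches a SECOND ARC of the circle (global nodal topology).  Weaker than `TongueSealQ`. -/
def TongueSealNRQ : Prop :=
  ∀ (η : ℝ) (f : ℂ → ℂ) (x₀ s hmax R Hs : ℝ) (B : ℕ), EngineHyps5 2 η f x₀ s hmax R Hs B → ∀ (j : ℕ) (a v : ℂ),
    iteratedDeriv j f a = 0 → 0 < a.im → NoTallerToucher f j a → Atomic f j a v →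
    iteratedDeriv (j + 1) f a ≠ 0 → iteratedDeriv (j + 1) f v ≠ 0 → NoRealZero f j a → ∃ d0 > 0, ∃ E : Set ℝ, E.Finite ∧ ∀ δ ∈ Ioo 0 d0 \ E,
      ∀ t₁ t₂ t₃ t₄ : ℝ, BadPiece f j a δ t₁ t₂ → BadPiece f j a δ t₃ t₄ → t₂ ≤ t₃ →
        (∀ t ∈ Icc t₂ t₃, (arcPhi f j a δ t).im ≤ 0) → SealingPath f j a δ t₂ t₃

/-- ★ GAP ORDER ON THE NO-TOOTH CLASS (OPEN): part Lʼs `AtomicGapOrderLawQ` with the extra binder `NoRealZero f j a`. -/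
def AtomicGapOrderLawNRQ : Prop :=
  ∀ (η : ℝ) (f : ℂ → ℂ) (x₀ s hmax R Hs : ℝ) (B : ℕ), EngineHyps5 2 η f x₀ s hmax R Hs B → ∀ (j : ℕ) (a v : ℂ),
    iteratedDeriv j f a = 0 → 0 < a.im → NoTallerToucher f j a → Atomic f j a v →
    iteratedDeriv (j + 1) f a ≠ 0 → iteratedDeriv (j + 1) f v ≠ 0 → NoRealZero f j a →
    ∃ d0 > 0, ∃ E : Set ℝ, E.Finite ∧ ∀ δ ∈ Ioo 0 d0 \ E, ArcGapOrder f j a δ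

/-- ★ THE TOOTH RESIDUAL (OPEN): part Lʼs gap order on the class WITH a real zero of `f^{(j)}` in the closed Jensen interval.  Conjecturally true by
COMPENSATION (the upward jump of `Re φ` at the tooth is repaid along the tongue walk; C6 g37: 0 / 247 360 tooth insertions broke ORDER), not by sealing. -/
def AtomicGapOrderLawToothQ : Prop :=
  ∀ (η : ℝ) (f : ℂ → ℂ) (x₀ s hmax R Hs : ℝ) (B : ℕ), EngineHyps5 2 η f x₀ s hmax R Hs B → ∀ (j : ℕ) (a v : ℂ),
    iteratedDeriv j f a = 0 → 0 < a.im → NoTallerToucher f j a → Atomic f j a v →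
    iteratedDeriv (j + 1) f a ≠ 0 → iteratedDeriv (j + 1) f v ≠ 0 → ¬ NoRealZero f j a →
    ∃ d0 > 0, ∃ E : Set ℝ, E.Finite ∧ ∀ δ ∈ Ioo 0 d0 \ E, ArcGapOrder f j a δ

/-! ## §2 Bookkeeping (PROVED): restrictions, seal ⇒ gap order on the class, the glued split, corollaries -/

/-- Part Mʼs seal restricts to the no-tooth class. -/
theorem tongueSealNR_of_tongueSeal (h : TongueSealQ) : TongueSealNRQ :=
  fun η f x₀ s hmax R Hs B hE j a v ha hapos hN hA hda hdv _ => h η f x₀ s hmax R Hs B hE j a v ha hapos hN hA hda hdv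

/-- Part Lʼs law restricts to the no-tooth class … -/
theorem atomicGapOrderLawNR_of_law (h : AtomicGapOrderLawQ) : AtomicGapOrderLawNRQ :=
  fun η f x₀ s hmax R Hs B hE j a v ha hapos hN hA hda hdv _ => h η f x₀ s hmax R Hs B hE j a v ha hapos hN hA hda hdv

/-- … and to the tooth class. -/
theorem atomicGapOrderLawTooth_of_law (h : AtomicGapOrderLawQ) : AtomicGapOrderLawToothQ :=
  fun η f x₀ s hmax R Hs B hE j a v ha hapos hN hA hda hdv _ => h η f x₀ s hmax R Hs B hE j a v ha hapos hN hA hda hdv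

/-- ★ SEAL ⇒ GAP ORDER on the no-tooth class (part Mʼs `re_le_of_sealingPath`, pointwise). -/
theorem atomicGapOrderLawNR_of_tongueSealNR (h : TongueSealNRQ) : AtomicGapOrderLawNRQ := by
  intro η f x₀ s hmax R Hs B hE j a v ha hapos hN hA hda hdv hT
  obtain ⟨d0, hd0, E, hEfin, hS⟩ := h η f x₀ s hmax R Hs B hE j a v ha hapos hN hA hda hdv hT
  have hGd : Differentiable ℂ (iteratedDeriv j f) := differentiable_iteratedDeriv_of_entire (realEntireLt2_of_hyps hE).diff j
  exact ⟨d0, hd0, E, hEfin, fun δ hδ t₁ t₂ t₃ t₄ h₁ h₂ h23 hgap => re_le_of_sealingPath hGd (hS δ hδ t₁ t₂ t₃ t₄ h₁ h₂ h23 hgap)⟩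

/-- ★★ THE GLUED TOOTH SPLIT (exact): `AtomicGapOrderLawNRQ → AtomicGapOrderLawToothQ → AtomicGapOrderLawQ`. -/
theorem atomicGapOrderLaw_of_toothSplit (hNR : AtomicGapOrderLawNRQ) (hT : AtomicGapOrderLawToothQ) : AtomicGapOrderLawQ := by
  intro η f x₀ s hmax R Hs B hE j a v ha hapos hN hA hda hdv
  by_cases h0 : NoRealZero f j a
  · exact hNR η f x₀ s hmax R Hs B hE j a v ha hapos hN hA hda hdv h0
  · exact hT η f x₀ s hmax R Hs B hE j a v ha hapos hN hA hda hdv h0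

/-- The split is exact: part Lʼs law is equivalent to the conjunction of its two restrictions. -/
theorem atomicGapOrderLaw_iff_toothSplit : AtomicGapOrderLawQ ↔ AtomicGapOrderLawNRQ ∧ AtomicGapOrderLawToothQ :=
  ⟨fun h => ⟨atomicGapOrderLawNR_of_law h, atomicGapOrderLawTooth_of_law h⟩, fun h => atomicGapOrderLaw_of_toothSplit h.1 h.2⟩

/-- ★★ … hence the SEAL on the no-tooth class + the tooth residual give part Lʼs law … -/
theorem atomicGapOrderLaw_of_sealNRSplit (h : TongueSealNRQ) (hT : AtomicGapOrderLawToothQ) : AtomicGapOrderLawQ :=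
  atomicGapOrderLaw_of_toothSplit (atomicGapOrderLawNR_of_tongueSealNR h) hT

/-- … part Iʼs residual (with part Jʼs non-atomic residual, via parts L/J) … -/
theorem topPinningResidual_of_toothSplit (hNR : AtomicGapOrderLawNRQ) (hT : AtomicGapOrderLawToothQ) (hR : NonAtomicTopResidualQ) :
    TopPinningNonNestedAscResidual :=
  topPinningResidual_of_gapOrderSplit (atomicGapOrderLaw_of_toothSplit hNR hT) hR

/-- … the same from the no-tooth SEAL … -/
theorem topPinningResidual_of_sealNRSplit (h : TongueSealNRQ) (hT : AtomicGapOrderLawToothQ) (hR : NonAtomicTopResidualQ) :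
    TopPinningNonNestedAscResidual :=
  topPinningResidual_of_toothSplit (atomicGapOrderLawNR_of_tongueSealNR h) hT hR

/-- … and `TopPinning`. -/
theorem topPinning_of_toothSplit (hNR : AtomicGapOrderLawNRQ) (hT : AtomicGapOrderLawToothQ) (hR : NonAtomicTopResidualQ) : TopPinning :=
  topPinning_of_nonNestedAscResidual (topPinningResidual_of_toothSplit hNR hT hR)

/-- Sanity: a no-tooth top has clean feet in the zero sense — the two feet of its Jensen circle are not zeros of `f^{(j)}`. -/
theorem feet_ne_zero_of_noRealZero {f : ℂ → ℂ} {j : ℕ} {a : ℂ} (h : NoRealZero f j a) (ha : 0 < a.im) :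
    iteratedDeriv j f ((a.re - a.im : ℝ) : ℂ) ≠ 0 ∧ iteratedDeriv j f ((a.re + a.im : ℝ) : ℂ) ≠ 0 :=
  ⟨h _ (by rw [show a.re - a.im - a.re = -a.im by ring, abs_neg, abs_of_pos ha]),
   h _ (by rw [show a.re + a.im - a.re = a.im by ring, abs_of_pos ha])⟩

end RhW08.Lens1ArcSign
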